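/-
Copyright: lit-balaban Phase-2 proof seat p27 (gen 37).  Statement-level skeleton of a published paper; no proof claims beyond what the
kernel checks below.
-/
import Literature.MathematicalPhysics.QuantumFieldTheory.BalabanImbrieJaffe1984to88.BIJ88NeumannPropagatorSmallFieldCubeHolderDecay
import Literature.MathematicalPhysics.QuantumFieldTheory.BalabanImbrieJaffe1984to88.BIJ88NeumannPropagatorSmallFieldClose
import Literature.MathematicalPhysics.QuantumFieldTheory.BalabanImbrieJaffe1984to88.BIJ88NeumannPropagatorSmallFieldCloseDeriv

/-!
# [Balaban1983RegularityDecay] Theorem p. 573 (1.11)–(1.12) / [BalabanImbrieJaffe1985] §7.3 p. 326 / [BalabanImbrieJaffe1988] p. 263 —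
# **THE HÖLDER MEMBER (ORDER `1+α`) OF THE `δG_k(□,Ω)` CLOSENESS CLAUSE AT SMALL NON-FLAT `U(1)` FIELDS, `k`-UNIFORM, OPERATOR (`‖f‖_∞`)
# FORM, FOR NESTED `k`-BLOCK UNIONS `□ ⊆ Ω` OF THE TORUS** — from the value member and the covariant-derivative member of the clause

T. Bałaban, *Regularity and decay of lattice Green's functions*, Commun. Math. Phys. **89** (1983) 571–597 [Balaban1983RegularityDecay]
(= [7] of [BalabanImbrieJaffe1985], [6] of [BalabanImbrieJaffe1988]), Theorem p. 573 [PDF 3]: *"For α < 1 there exist positive constants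
δ₀, c₀, R₀ independent of A, k, Ω and depending on d, M only, c₀ on α also, such that … 1/|x − x′|^α |U(A(Γ_{x,x′}))(D^η_{A,μ}G_k(Ω,A)f)(x′)
− (D^η_{A,μ}G_k(Ω,A)f)(x)| ≦ c₀exp(−δ₀dist({x,x′}, supp f))‖f‖_∞ (1.9) for x, x′ ∈ Ω, and satisfying the condition dist({x,x′},Ω^c) ≧ R₀.
… If Ω ⊂ Ω₀, then for δG_k(Ω,Ω₀,A) = G_k(Ω,A) − G_k(Ω₀,A), (1.11) we have the inequalities (1.5) and (1.6) (with the same restrictions on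
x, x′) with the additional factor exp(−δ₀dist(x,Ω^c))exp(−δ₀dist(supp f,Ω^c)) (1.12) on the right hand sides"*; T. Bałaban, J. Imbrie,
A. Jaffe, *Renormalization of the Higgs model: minimizers, propagators and the stability of mean field theory*, Commun. Math. Phys. **97**
(1985) 299–329 [BalabanImbrieJaffe1985], §7.3 p. 326 [PDF 28]: *"The propagators arising from Δ_k(u_k), under the restriction (7.3.1) on the
gauge field, also satisfy the regularity and decay estimates of [7]"*; T. Bałaban, J. Imbrie, A. Jaffe, *Effective action and cluster
properties of the abelian Higgs model*, Commun. Math. Phys. **114** (1988) 257–315 [BalabanImbrieJaffe1988], p. 263 [PDF 7], after (2.31)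
`|G̃_k(u; x, x′) − G_{k,loc}(u; x, x′)| ≦ O(1)exp(−δ₁r(e_k))exp(−δ dist(x, x′))`: *"Bounds analogous to (2.30), (2.31) hold for covariant
derivatives and Hölder derivatives of G_{k,loc}(u) of order less than two."*

statement-level skeleton of published theorems with citation tags; proofs where landed; nothing here is a claim about the Yang–Mills mass gap

PDFs held: `paper:balaban1983-cmp89-regularity-decay` (p. 573 [PDF 3]); `paper:balaban1985-cmp97-bij-higgs-minimizers` (p. 326 [PDF 28]);
`paper:balaban1988-cmp114-bij-abelian-higgs-effective-action` (p. 263 [PDF 7]) — the three sentences above re-read on the materialised pages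
by this seat's gens 34–36 (same pages, same wording).

CITATION HEADER (lean-in-tree rule).  Part of the lit-balaban TYPED SKELETON (HOME `run/shared/lean/pub/lit-balaban/`), PHASE-2 proof seat
p27 gen 37 (unit `lit-balaban-p27-g37`; TAKING line HOME/STATUS.md 2026-08-23T06:25:40Z, free-target protocol G.5-34(d), objection/priority
window → 06:55Z: p29 g30 «NO OBJECTION» 06:29:57Z (binder suggestion adopted in §7), r01 g37 «NO OBJECTION, no priority claim» 06:30:34Z,
r15 g15 «NO OBJECTION» 06:30:41Z, p30 g28 FILED note 06:33:53Z «p27 g37 takes the HÖLDER twin `…CloseHolder` with this member as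
hypothesis», r18 g25 «TAKING noted (no objection from the fold owner)» 06:35:13Z).  WHAT THIS FILE IS: the `δG` (closeness-clause) twin of this
seat's gen-35 cube Hölder files `BIJ88NeumannPropagatorSmallFieldCubeHolder` (p351200: the leg estimate in the axis-rooted gauge) and
`BIJ88NeumannPropagatorSmallFieldCubeHolderDecay` (p351875: gauge-invariant form, all deep pairs, input binder) — p30 gen 26's LOCAL two-bond
interior Hölder estimate `BIJ85ScalarPropagatorSupDecayHolder.local_holder_bound` transplanted to the DIFFERENCE `v = G_k(□,u)f − G_k(Ω,u)f` of
p31's region Neumann propagators `G_k(X,u) = gBox (α_kL^{kd}) ε⁻¹ u k X` ([BalabanImbrieJaffe1988] (2.27)/(5.6.10)) on NESTED `k`-block unions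
`□ ⊆ Ω`, which is `N(u)`-harmonic on the interior of `□` (p30 gen 27) so that the local source term of the estimate VANISHES; the values and the
covariant differences of `v` near the pair — the two other members of the clause — enter as ABSTRACT local data (§2–§4), then as the members
themselves (§5: hypotheses in the conclusion shapes of p30's `close112_smallField_of_inputs` (p353959) and `close112_smallField_deriv_of_inputs`
(p355499); §6–§7: the value member discharged BY NAME; §8: BOTH discharged BY NAME — the member from the four (H1.10″) inputs).  Rows served on ACCEPT (cells only, no head change):
**C2.Eq2.31 / C2.Claim@263** (owner r18: located INPUT member — the small-field twin of r01's `holder_covD_gBox_sub_gBox_univ_le` = term (a) of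
the eight-term split of `BIJ88LocDerivHolder231RegularTorus` for *"the order-(1+θ) member of (2.31) at SMALL u"*, C2S14-CLOSURE v1.16v),
**C1.Eq7.3.1-7.3.2** (owner r15: located member — the (1.11)–(1.12) HÖLDER clause of the p. 326 sentence at small non-flat fields, nested block
unions), **B4.Thm@573** (owner r01: located input/consumer token at plaquette-small `u`, method divergence as below).  USED BY NAME, never
restated: p30's `local_holder_bound` / `div_rpow_mul_eq` / `rpow_neg_le_of_le_mul` / `rpow_le_mul_rpow` (`BIJ85ScalarPropagatorSupDecayHolder`),
`flat_kernel_holder` (`BIJ85FlatPropagatorKernelHolder`), `centredGaugeDir` / `dist1_centredGaugeDir_le(_min)` (`BIJ85BiCentredAxialGauge`),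
`norm_covDiff_gaugeAct` / `dist1_plaqHol_le_of_plaqC` / `two_mul_pow_le_sitesPerDir` / `gamma_nsq_le_one` (`BIJ85ScalarPropagatorSupDecayDeriv`),
`axisHol` / `axisHol_gaugeAct` / `toC_axisHol_eq_one` / `covD_gaugeAct` / `runSite_apply_ne` / `supDist_runSite_eq` / `stairPt…` / `legHol` /
`stairHol` / `norm_stairHol` / `stair_telescope` / `min_val_le_supDist` (`BIJ85ScalarPropagatorHolderDecay`), `close112_smallField_of_inputs`
(`BIJ88NeumannPropagatorSmallFieldClose`), `close112_smallField_deriv_of_inputs` (`BIJ88NeumannPropagatorSmallFieldCloseDeriv`), `plaqC` /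
`plaqC_self` (`BIJ85AbelianStokes`); this seat's `source_eq_on_ball`
(`BIJ88NeumannPropagatorSmallFieldCubeHolder`); p31's `nOp` / `gBox` / `IsBlockUnion`; p38's `B5Ineq137Torus.T` (`T_triangle`, `T_nonneg`,
`T_self`, `B3Bound323ZeroTorus.T_eq_supDist`); r18's `covD` / `cfg` / `toC` (`BIJ88Sect3Statements`).

THE MATHEMATICS (ours — DIVERGENCE OF METHOD from the printed route, disclosed as in this seat's gen-34/35 files and p30's/p34's: the print
([BalabanImbrieJaffe1985] p. 326, [BalabanImbrieJaffe1988] p. 263) defers to an extension of [Balaban1983RegularityDecay], whose proof of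
(1.11)–(1.12) (p. 579) is a random-walk cancellation; here p30's perturbative interior Hölder estimate is applied to the `N(u)`-harmonic
difference).  Let `□ ⊆ Ω` be `k`-block unions, `v = G_k(□,u)f − G_k(Ω,u)f`.  (§1) At a site `z ∈ □` all of whose lattice neighbours lie in
`□`, the torus source of the gauge copy `h·v` vanishes: `(N_T(u^h)(h·v))(z) = h(z)f(z) − h(z)f(z) = 0` (p34's interior identity + gauge covariance
for BOTH propagators).  (§2) Fix an axis-parallel pair `x₀`, `x₁ = x₀ + ρe_i` (`1 ≤ ρ ≤ L^k/64`), `r = ⌊L^k/8⌋`, p30's axis-rooted tree gauge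
`h = centredGaugeDir u x₀ (2r) i` of the `2r`-ball (all bonds based on the axis segment trivial, gauge weight `γ·min(|z−x₀|,|z−x₁|)`,
`γ = (d−1)θ`, `γL^{2k} ≤ 1` from `2d³(L^{2k}θ)² ≤ 1`).  When `x₀` is `L^k`-deep in `□` the `(2r+1)`-ball lies in `□`, so p30's
`local_holder_bound` — which takes the torus equation `N_T(u^h)ψ = f′` globally but reads `f′` only on the `2r`-ball — applies to `ψ = h·v`
with `F_loc = 0`, the flat Hölder envelopes `A = C_Hε²ρ^α` of `flat_kernel_holder`, and ANY reals `S ≥ sup_{(2r+L^k+1)-ball}‖v‖`,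
`M_loc ≥ sup_{2r-ball}‖u_bv(b₊) − v(b₋)‖`; its four surviving terms are `ε⁻²γA·rr^{1−α}M_loc ≤ C_H(ρ/L^k)^αM_loc`,
`ε⁻²γA·r^{1−α}S ≤ C_H(ρ/L^k)^α·S/L^k`, `ε⁻²AS·r^{−α−1} ≤ 256C_H(ρ/L^k)^α·S/L^k`, `α_kA(r+L^k)^{1−α}S ≤ 2aC_H(ρ/L^k)^α·S/L^k` (using `γL^{2k} ≤ 1`,
`L^k ≤ 16r`, `α_k(L^kε)² ≤ a`), whence `‖ΔΔψ‖ ≤ c₀(ρ/L^k)^α(M_loc + S/L^k)`.  (§3) Gauge covariance of the three factors (abelian) gives the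
invariant form `‖U([x₀,x₁])·(D_uv)(x₁,μ) − (D_uv)(x₀,μ)‖ ≤ c₀(ρ/L^k)^α·ε⁻¹(M_loc + S/L^k)` exactly as in the gen-35 file.  (§4) All pairs: near
pairs (`64|x₀−x₁|_∞ ≤ L^k`) by p30's shortest staircase of `d` axis legs (every corner within `|x₀−x₁|_∞` of `x₀`, hence `L^k`-deep when `x₀` is
`2L^k`-deep, and its data balls inside the `2L^k`- and `L^k`-balls about `x₀`), telescoped by `stair_telescope`; far pairs: `‖D_uv‖ = ε⁻¹‖u_bv(b₊) −
v(b₋)‖ ≤ ε⁻¹M_loc` at both bonds and `(L^k/|x₀−x₁|)^α ≤ 64`.  (§5) Reading `S`, `M_loc` off the two members of the clause on the `2L^k`-balls about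
the pair (every such site lies in `□` at depth `≥ (R+1)L^k` when the pair is `(R+3)L^k`-deep, and sees `supp f` / `T∖□` at distances `≥ D − 2L^k` /
`≥ D_b − 2L^k`, costing `e^{2δ}` twice): `S = (L^kε)²c₁e^{4δ}E·F`, `M_loc = ε(L^kε)c₂e^{4δ}E·F`, `E = e^{−δD/L^k}e^{−δ(D_b+D_f)/L^k}`,
`δ = min(δ₁,δ₂)`, so `ε⁻¹(M_loc + S/L^k) = (L^kε)(c₁+c₂)e^{4δ}E·F` — ONE power of `L^kε`, as the covariant-derivative member.

WHAT IS PROVED (theorems only; 0 `sorry`; standard axioms; no definition, no `Prop`-valued fact; four private kernel lemmas).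
* §1 **`harmonic_gauged_on_interior`** — `(N_T(u^h)(h·(G_k(□,u)f − G_k(Ω,u)f)))(z) = 0` at every `z ∈ □` with `z ± e_ν ∈ □` (`□ ⊆ Ω` block
  unions, any gauge transformation `h`); `ball_subset_of_deep`.
* §2 **`closeHolder_leg_gauged`** — for `P.d = d ≥ 2`, `L` odd `> 1`, `a > 0`, `0 ≤ α < 1` THERE IS `c₀ > 0` (on `d, L, a, α`) such that for every
  volume, `1 ≤ k ≤ K`, nested `k`-block unions `□ ⊆ Ω`, every `U(1)` field with all oriented plaquettes within `θ` of `1` and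
  `2d³(L^{2k}θ)² ≤ 1`, every axis-parallel pair `x₀, x₁` (`1 ≤ |x₀−x₁|_∞`, `64|x₀−x₁|_∞ ≤ L^k`) with `x₀` `L^k`-deep in `□`, every `f`, and all
  reals `S ≥ 0`, `M_loc ≥ 0` bounding `‖v‖` on the `(2⌊L^k/8⌋+L^k+1)`-ball and `‖u_{⟨z,ν⟩}v(z+e_ν) − v(z)‖` on the `2⌊L^k/8⌋`-ball about `x₀`: (a) every
  bond based on the axis segment is trivial for `u^h`, `h = centredGaugeDir u x₀ (2⌊L^k/8⌋) i`; (b) for `ψ = h·v`,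
  `‖(ψ(x₁+e_μ) − ψ(x₁)) − (ψ(x₀+e_μ) − ψ(x₀))‖ ≤ c₀(|x₀−x₁|_∞/L^k)^α(M_loc + S/L^k)`.
* §3 **`closeHolder_leg`** — the gauge-invariant form: `‖U([x,x+ρe_i])·(D_uv)(⟨x+ρe_i,μ⟩) − (D_uv)(⟨x,μ⟩)‖ ≤ c₀(ρ/L^k)^α·ε⁻¹(M_loc + S/L^k)`.
* §4 **`closeHolder_of_local`** — ALL PAIRS `x₀ ≠ x₁` both `2L^k`-deep in `□`, data on the balls `{min(|x₀−z|,|x₁−z|) ≤ 2L^k}` (values) and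
  `{… ≤ L^k}` (covariant differences): `(L^k/|x₀−x₁|_∞)^α·‖U(Γ_{x₀,x₁})(D_uv)(⟨x₁,μ⟩) − (D_uv)(⟨x₀,μ⟩)‖ ≤ c₁·ε⁻¹(M_loc + S/L^k)`, `Γ` = p30's
  `stairHol`, `c₁ = d·c₀ + 128`.
* §5 **`closeHolder112_of_members`** — THE MEMBER from the two members of the clause as hypotheses: value member on the rows of `□` at depth
  `≥ R₁L^k` with `(c₁,δ₁)` (p30's `close112_smallField_of_inputs` conclusion shape verbatim, `R₁` in place of `10`), covariant-derivative member
  on the rows at depth `≥ R₂L^k` with `(c₂,δ₂)` (p30's `close112_smallField_deriv_of_inputs` conclusion shape verbatim, `R₂` in place of `14`)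
  ⟹ `∃ c₃ δ₃ > 0` (`δ₃ = min(δ₁,δ₂)`, `c₃ = c_{§4}(c₁+c₂)e^{4δ₃} + 1`): for every pair of distinct rows of `□` both at depth `≥ (max(R₁,R₂)+3)L^k`,
  every `μ`, every `f` supported in `□` (`‖f‖ ≤ F`, `0 ≤ D ≤ dist(x_i, supp f)`, `0 ≤ D_b ≤ dist(x_i, T∖□)`, `0 ≤ D_f ≤ dist(supp f, T∖□)`, p38's
  metric `T`): `(L^k/T(x₀,x₁))^α·‖U(Γ_{x₀,x₁})(D_uv)(⟨x₁,μ⟩) − (D_uv)(⟨x₀,μ⟩)‖ ≤ (L^kε)·c₃e^{−δ₃D/L^k}e^{−δ₃(D_b+D_f)/L^k}F`.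
* §6 **`closeHolder112_smallField_of_inputs`** — §5 with the value member DISCHARGED BY NAME by p30's `close112_smallField_of_inputs`
  (`2 ≤ d ≤ 3`): hypotheses = p30's (the (H1.10″) value members `hGB`, `hGΩ` of `G_k(□,u)`, `G_k(Ω,u)` on the rows of `□` with `(c₀,δ₀)`) + the
  covariant-derivative member of the clause with `(c₂,δ₂,R₂)`; pairs at depth `≥ (max(10,R₂)+3)L^k`.
* §7 **`closeHolder112_smallField_input`** — §6 in the (H1.12)-Hölder INPUT BINDER SHAPE of the hypothesis-form chain, parallel to r18's
  `BIJ88LocDerivHolder231RegularTorus.input112_holder_regular_univ` (direction first, `x₁ ≠ x₀`, deep rows as ball conditions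
  `T(x_i,y) ≤ (max(10,R₂)+3)L^k → y ∈ □`, no sign conditions on `D, D_b, D_f`), transport `stairHol` — p29 g30's request 06:29:57Z.
* §8 **`closeHolder112_smallField_of_inputs110`** / **`closeHolder112_smallField_input110`** — BOTH members of the clause discharged BY NAME
  (p30's p353959 + p355499): hypotheses = EXACTLY those of `close112_smallField_deriv_of_inputs` (the (H1.10″) value members `hGB`/`hGΩ` and
  covariant-derivative members `hDB`/`hDΩ` of `G_k(□,u)`, `G_k(Ω,u)`, all at one `(c₀,δ₀)`), pairs at depth `≥ 17L^k` (depth form / ball form).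
  With it the three members (value, covariant derivative, Hölder) of (1.11)–(1.12) at small non-flat `U(1)` fields are in the tree in
  `k`-uniform operator form modulo the (H1.10″) inputs, whose producers are all landed.

HONEST SCOPE.  (i) DEEP PAIRS ONLY: both rows `(max(R₁,R₂)+3)L^k`-deep below `T∖□` — with p30's producers (`R₁ = 10`, `R₂ = 14`) this is
`17` units of the `L^{−k}`-lattice, our reading of [Balaban1983RegularityDecay]'s `R₀`; nothing is claimed nearer the boundary of `□` (no
reflected kernels).  (ii) MEMBERS AS HYPOTHESES: the value member of the clause is discharged by name in §6–§7 (p30 p353959, itself taking the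
(H1.10″) value members of `G_k(□,u)`, `G_k(Ω,u)` as hypotheses — producers: this seat's torus/cube/region members p341384 / p347259 / p354606,
p34's p349321 / p354902); the COVARIANT-DERIVATIVE member of the clause is a HYPOTHESIS in §5–§7, in the exact conclusion shape of p30 g28's
`close112_smallField_deriv_of_inputs` (p355499 ✓ 9ae02ea7fd46) with a free depth `R₂`, and is DISCHARGED by that theorem in §8 (`R₂ = 14`); what
remain hypotheses in §8 are the four (H1.10″) members of `G_k(□,u)` and `G_k(Ω,u)` — exactly as in p30's two files.  (iii) `U(1)` (p31's carrier); `P.d = d ≥ 2` in §2–§5 (`flat_kernel_holder`), `2 ≤ d ≤ 3` in §6–§7 (p30's tilted-row input); `L` odd `> 1`;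
`1 ≤ k ≤ K`; `0 ≤ α < 1` (referee ruling G-ref1-32 on the printed «α < 0»); the contour is p30's explicit shortest staircase `stairHol` (the print
allows any shortest contour; r01's regular-`A` provider transports along an arbitrary `IsSChain` by `holA` — no `stairHol ↔ holA` bridge is
claimed).  (iv) ONE power of `L^kε` on the right, as the covariant-derivative member (the value member has two).  (v) The plaquette hypothesis
is p30's oriented form `‖plaqC u y μ ν − 1‖ ≤ θ` with the block-scale smallness `2d³(L^{2k}θ)² ≤ 1`; THE PRINTED (7.3.1) constrains the
UNIT-lattice plaquettes of `v` (`|v(∂p) − 1| ≦ e_kμ(e_k)`, p. 326 L13–14), the files' `θ` the FINE plaquettes of `u` — `θ ≲ L^{−2k}` is the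
consistent block-scale reading but nothing is asserted about the passage (p33's lane; referee ref-5 D-g64-1).  (vi) Constants explicit in the
proofs (§2 `c₀ = C_LC_H(257+2a) + 1`, §4 `c_{§4} = d·c₀ + 128`, §5 `δ₃ = min(δ₁,δ₂)`, `c₃ = c_{§4}(c₂+c₁)e^{4δ₃} + 1`); `set_option maxHeartbeats 800000` on §2 and
`400000` on §4–§5 (p30's bookkeeping).  (vii) This is an INPUT of the order-`(1+θ)` member of (2.31) at small `u`, not that member.  DIVERGENCE OF
METHOD as stated.  Nothing here is summit progress, continuum or Clay.  Unit `lit-balaban-p27` (literature-prover-lit-balaban-p27-g37-0), HOME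
`run/shared/lean/pub/lit-balaban/`, 2026-08-23.
-/

open scoped BigOperators ComplexConjugate
open Finset Matrix

namespace Literature.MathematicalPhysics.QuantumFieldTheory.BalabanImbrieJaffe1984to88.BIJ88NeumannPropagatorSmallFieldCloseHolder

open Literature.MathematicalPhysics.QuantumFieldTheory.Balaban1983to89
open LatticeFieldCalculus (supDist runSite runSite_zero runSite_succ)
open B3TorusRadialSums (cdist cdist_le_supDist supDist_comm supDist_eq_sup_cdist supDist_eq_zero_iff cdist_neg)
open BIJ85Ineq722Torus (supDist_triangle supDist_runSite_le)
open BIJ88Sect3Statements (U1 toC cfg covD starB mem_starB norm_toC toC_one toC_mul toC_inv)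
open BIJ88NeumannNoZeroModesTorus (IsBlockUnion)
open BIJ88NeumannPropagator227Torus (nOp gBox conj_mul_toC toC_mul_conj)
open GaugeField (gaugeAct plaqHol)
open BIJ85ScalarPropagatorSupDecayDeriv (norm_covDiff_gaugeAct dist1_plaqHol_le_of_plaqC two_mul_pow_le_sitesPerDir gamma_nsq_le_one)
open BIJ85TorusTentCutoff (supDist_shift_le_succ supDist_unshift_le_succ)
open BIJ85BiCentredAxialGauge (centredGaugeDir dist1_centredGaugeDir_le dist1_centredGaugeDir_le_min)
open BIJ85ScalarPropagatorSupDecayHolder (local_holder_bound div_rpow_mul_eq rpow_neg_le_of_le_mul rpow_le_mul_rpow)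
open BIJ85ScalarPropagatorHolderDecay (axisHol axisHol_zero axisHol_gaugeAct toC_axisHol_eq_one covD_gaugeAct runSite_apply_ne
  supDist_runSite_eq stairPt stairPt_zero stairPt_of_le supDist_stairPt_le stairPt_succ_eq_runSite stairPt_eq_runSite_succ min_val_le_supDist
  legHol stairHol norm_stairHol stair_telescope)
open BIJ88NeumannPropagatorSmallFieldCubeHolder (source_eq_on_ball)
open BIJ88NeumannPropagatorSmallFieldClose (close112_smallField_of_inputs)
open BIJ88NeumannPropagatorSmallFieldCloseDeriv (close112_smallField_deriv_of_inputs)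
open BIJ85AbelianStokes (plaqC plaqC_self)

noncomputable section

variable {P : Params}

/-! ## §1 The gauge copy of `v = G_k(□)f − G_k(Ω)f` is `N_T(u^h)`-harmonic on the interior of `□` -/

section Harmonic

/-- kernel: **`h·(G_k(□,u)f − G_k(Ω,u)f)` IS `N_T(u^h)`-HARMONIC AT EVERY INTERIOR SITE OF `□`** (`□ ⊆ Ω` block unions, any gauge
transformation `h`): at `z ∈ □` with `z ± e_ν ∈ □` the torus sources of the gauge copies of the two solutions are both `h(z)f(z)` (p34's
interior identity and gauge covariance, composed in `BIJ88NeumannPropagatorSmallFieldCubeHolder.source_eq_on_ball`), so their difference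
has source `0` there — the gauged form of p30's `BIJ88NeumannPropagatorSmallFieldClose.nOp_univ_diff_apply_eq_zero`.
[cite: Balaban1983RegularityDecay, Theorem p.573 (1.11)] [cite: BalabanImbrieJaffe1988, (2.27) p.263] -/
theorem harmonic_gauged_on_interior {k : ℕ} (hk : 0 + k ≤ P.m + P.K) {a c : ℝ} (hc : c ≠ 0) (ha : 0 < a) (h : GaugeTransf P 0 U1)
    (U : GaugeField P 0 U1) {B Ω : Finset (Balaban1983to89.Site P 0)} (hB : IsBlockUnion k B) (hΩ : IsBlockUnion k Ω) (hsub : B ⊆ Ω)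
    (f : Balaban1983to89.Site P 0 → ℂ) {z : Balaban1983to89.Site P 0} (hz : z ∈ B) (hs : ∀ ν, z.shift ν ∈ B)
    (hu : ∀ ν, z.unshift ν ∈ B) :
    (nOp a c (gaugeAct h U) k univ *ᵥ fun w => toC (h w) * (gBox a c U k B *ᵥ f - gBox a c U k Ω *ᵥ f) w) z = 0 := by
  have e : (fun w => toC (h w) * (gBox a c U k B *ᵥ f - gBox a c U k Ω *ᵥ f) w) =
      (fun w => toC (h w) * (gBox a c U k B *ᵥ f) w) - fun w => toC (h w) * (gBox a c U k Ω *ᵥ f) w := by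
    funext w; simp only [Pi.sub_apply, mul_sub]
  rw [e, mulVec_sub, Pi.sub_apply, source_eq_on_ball hk hc ha h U hB f hz hs hu,
    source_eq_on_ball hk hc ha h U hΩ f (hsub hz) (fun ν => hsub (hs ν)) (fun ν => hsub (hu ν)), sub_self]

/-- kernel: **an `L^k`-deep centre has its `(2r+1)`-ball in `□`** (`r = ⌊L^k/8⌋`, `L^k ≥ 64`): if `L^k ≤ |x₀ − w|_∞` for every `w ∉ □`
then `|x₀ − w|_∞ ≤ 2r + 1 → w ∈ □`. [cite: Balaban1983RegularityDecay, Theorem p.573 «dist({x,x′},Ω^c) ≥ R₀»] -/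
theorem ball_subset_of_deep {k : ℕ} (h64 : 64 ≤ P.L ^ k) {Q : Finset (Balaban1983to89.Site P 0)} {x₀ : Balaban1983to89.Site P 0}
    (hdeep : ∀ w, w ∉ Q → P.L ^ k ≤ supDist x₀ w) :
    ∀ w, supDist x₀ w ≤ 2 * (P.L ^ k / 8) + 1 → w ∈ Q := by
  intro w hw
  by_contra hwQ
  have h1 := hdeep w hwQ
  have h2 : 8 * (P.L ^ k / 8) ≤ P.L ^ k := Nat.mul_div_le (P.L ^ k) 8
  omega

end Harmonic

/-! ## §2 The local two-bond Hölder estimate for `v` at an axis-parallel deep pair, in the axis-rooted gauge, ABSTRACT local data -/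

section Leg

set_option maxHeartbeats 800000 in
/-- **THE LOCAL HÖLDER LEG ESTIMATE FOR `v = G_k(□,u)f − G_k(Ω,u)f` AT AN AXIS-PARALLEL DEEP PAIR, IN THE AXIS-ROOTED GAUGE, FROM ABSTRACT
LOCAL DATA `(S, M_loc)`** — for [Balaban1983RegularityDecay] Theorem p. 573 *"If Ω ⊂ Ω₀, then for δG_k(Ω,Ω₀,A) … we have the inequalities
(1.5) and (1.6) [= (1.9), (1.10)] (with the same restrictions on x, x′) with the additional factor (1.12)"*, (1.9) being the Hölder member
*"|x−x′|^{−α}|U(A(Γ_{x,x′}))(D^η_{A,μ}G_k(Ω,A)f)(x′) − (D^η_{A,μ}G_k(Ω,A)f)(x)| ≤ …"*, and [BalabanImbrieJaffe1985] p. 326 *"The propagators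
arising from Δ_k(u_k), under the restriction (7.3.1) on the gauge field, also satisfy the regularity and decay estimates of [7]"*: for
`P.d = d ≥ 2`, `L` odd `> 1`, `a > 0`, `0 ≤ α < 1` there is `c₀ > 0` (on `d, L, a, α`) such that for every volume, every `1 ≤ k ≤ K`, every
pair of NESTED `k`-block unions `□ ⊆ Ω`, every `U(1)` field with `‖u(∂p) − 1‖ ≤ θ` (all oriented plaquettes), `2d³(L^{2k}θ)² ≤ 1`, every
AXIS-PARALLEL pair `x₀`, `x₁` (`x₁,ν = x₀,ν` for `ν ≠ i`, `1 ≤ |x₀−x₁|_∞`, `64|x₀−x₁|_∞ ≤ L^k`) with `x₀` `L^k`-deep in `□`, every `f`, and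
ALL reals `S ≥ sup_{|x₀−z|_∞ ≤ 2r+L^k+1}‖v(z)‖`, `M_loc ≥ sup_{|x₀−z|_∞ ≤ 2r}‖u_{⟨z,ν⟩}v(z+e_ν) − v(z)‖` (`r = ⌊L^k/8⌋`): in p30's axis-rooted
gauge `h = centredGaugeDir u x₀ (2r) i` every bond based on the axis segment is trivial and, for `ψ = h·v`,
`‖(ψ(x₁+e_μ) − ψ(x₁)) − (ψ(x₀+e_μ) − ψ(x₀))‖ ≤ c₀(|x₀−x₁|_∞/L^k)^α·(M_loc + S/L^k)`.  Method: p30's `local_holder_bound` at `r = ⌊L^k/8⌋` for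
the torus operator `N_T(u^h)` and `ψ`, whose torus source VANISHES on the `2r`-ball (§1: `v` is `N(u)`-harmonic on the interior of `□`),
with the flat Hölder envelopes `A = C_Hε²|x₀−x₁|^α` (`flat_kernel_holder`) and the gauge weight `γ = (d−1)θ`, `γL^{2k} ≤ 1`; the four
surviving terms are `≲ (|x₀−x₁|/L^k)^α·M_loc` and `≲ (|x₀−x₁|/L^k)^α·S/L^k` — no decay bookkeeping at this level.
[cite: Balaban1983RegularityDecay, Theorem p.573 (1.9), (1.11)–(1.12)] [cite: BalabanImbrieJaffe1985, (7.3.1) p.326] [cite: BalabanImbrieJaffe1988, p.263, (2.31)] -/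
theorem closeHolder_leg_gauged (d L : ℕ) (hd2 : 2 ≤ d) (hL : Odd L ∧ 1 < L) {a : ℝ} (ha : 0 < a) {α : ℝ} (hα0 : 0 ≤ α) (hα1 : α < 1) :
    ∃ c₀ : ℝ, 0 < c₀ ∧ ∀ (P : Params), P.d = d → P.L = L → ∀ k : ℕ, 1 ≤ k → k ≤ P.K →
      ∀ (B Ω : Finset (Balaban1983to89.Site P 0)), IsBlockUnion k B → IsBlockUnion k Ω → B ⊆ Ω →
      ∀ (U : GaugeField P 0 U1) (θ : ℝ), (∀ (y : Balaban1983to89.Site P 0) (μ ν : Fin P.d), ‖plaqC U y μ ν - 1‖ ≤ θ) →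
        2 * (P.d : ℝ) ^ 3 * (((P.L : ℝ) ^ k) ^ 2 * θ) ^ 2 ≤ 1 →
      ∀ (x₀ x₁ : Balaban1983to89.Site P 0) (i μ : Fin P.d), (∀ ν, ν ≠ i → x₁ ν = x₀ ν) →
        1 ≤ supDist x₀ x₁ → 64 * supDist x₀ x₁ ≤ P.L ^ k → (∀ w, w ∉ B → P.L ^ k ≤ supDist x₀ w) →
      ∀ (f : Balaban1983to89.Site P 0 → ℂ) (S Mloc : ℝ), 0 ≤ S → 0 ≤ Mloc →
        (∀ z, supDist x₀ z ≤ 2 * (P.L ^ k / 8) + P.L ^ k + 1 →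
          ‖(gBox (B1RG242Torus.α P a k * (P.L : ℝ) ^ (k * P.d)) P.eps⁻¹ U k B *ᵥ f -
              gBox (B1RG242Torus.α P a k * (P.L : ℝ) ^ (k * P.d)) P.eps⁻¹ U k Ω *ᵥ f) z‖ ≤ S) →
        (∀ z ν, supDist x₀ z ≤ 2 * (P.L ^ k / 8) →
          ‖cfg U ⟨z, ν⟩ * (gBox (B1RG242Torus.α P a k * (P.L : ℝ) ^ (k * P.d)) P.eps⁻¹ U k B *ᵥ f -
                gBox (B1RG242Torus.α P a k * (P.L : ℝ) ^ (k * P.d)) P.eps⁻¹ U k Ω *ᵥ f) (z.shift ν) -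
              (gBox (B1RG242Torus.α P a k * (P.L : ℝ) ^ (k * P.d)) P.eps⁻¹ U k B *ᵥ f -
                gBox (B1RG242Torus.α P a k * (P.L : ℝ) ^ (k * P.d)) P.eps⁻¹ U k Ω *ᵥ f) z‖ ≤ Mloc) →
        (∀ (z : Balaban1983to89.Site P 0) (μ' : Fin P.d), (∀ ν, ν ≠ i → z ν = x₀ ν) → supDist x₀ z ≤ supDist x₀ x₁ →
            cfg (gaugeAct (centredGaugeDir U x₀ (2 * (P.L ^ k / 8)) i) U) ⟨z, μ'⟩ = 1) ∧
        ‖(toC (centredGaugeDir U x₀ (2 * (P.L ^ k / 8)) i (x₁.shift μ)) *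
              (gBox (B1RG242Torus.α P a k * (P.L : ℝ) ^ (k * P.d)) P.eps⁻¹ U k B *ᵥ f -
                gBox (B1RG242Torus.α P a k * (P.L : ℝ) ^ (k * P.d)) P.eps⁻¹ U k Ω *ᵥ f) (x₁.shift μ) -
            toC (centredGaugeDir U x₀ (2 * (P.L ^ k / 8)) i x₁) *
              (gBox (B1RG242Torus.α P a k * (P.L : ℝ) ^ (k * P.d)) P.eps⁻¹ U k B *ᵥ f -
                gBox (B1RG242Torus.α P a k * (P.L : ℝ) ^ (k * P.d)) P.eps⁻¹ U k Ω *ᵥ f) x₁) -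
          (toC (centredGaugeDir U x₀ (2 * (P.L ^ k / 8)) i (x₀.shift μ)) *
              (gBox (B1RG242Torus.α P a k * (P.L : ℝ) ^ (k * P.d)) P.eps⁻¹ U k B *ᵥ f -
                gBox (B1RG242Torus.α P a k * (P.L : ℝ) ^ (k * P.d)) P.eps⁻¹ U k Ω *ᵥ f) (x₀.shift μ) -
            toC (centredGaugeDir U x₀ (2 * (P.L ^ k / 8)) i x₀) *
              (gBox (B1RG242Torus.α P a k * (P.L : ℝ) ^ (k * P.d)) P.eps⁻¹ U k B *ᵥ f -
                gBox (B1RG242Torus.α P a k * (P.L : ℝ) ^ (k * P.d)) P.eps⁻¹ U k Ω *ᵥ f) x₀)‖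
          ≤ c₀ * ((supDist x₀ x₁ : ℝ) / (P.L : ℝ) ^ k) ^ α * (Mloc + S / (P.L : ℝ) ^ k) := by
  classical
  obtain ⟨C_H, hCH, hhol⟩ := BIJ85FlatPropagatorKernelHolder.flat_kernel_holder d L hd2 hL ha (le_refl (0 : ℝ)) hα0 hα1
  obtain ⟨C_L, hCL, hloc⟩ := local_holder_bound d (by omega) hα0 hα1
  set K₁ : ℝ := C_L * (C_H * (257 + 2 * a)) with hK₁
  refine ⟨K₁ + 1, by positivity, ?_⟩
  intro P hPd hPL k hk1 hkK B Ω hB hΩ hsub U θ hθ hsmall x₀ x₁ i μ hx₁ hρ1 hρ64 hdeep f S Mloc hS0 hMloc0 hSv hMv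
  have hk : k ≤ P.m + P.K := hkK.trans (Nat.le_add_left _ _)
  have hk0 : 0 + k ≤ P.m + P.K := by omega
  have hholP := hhol P hPd hPL k hk1 hkK
  -- basic quantities
  have hd1' : 1 ≤ P.d := by omega
  have hLpos : (0 : ℝ) < P.L := P.cast_L_pos
  have hL1 : (1 : ℝ) < P.L := B1RG242Torus.one_lt_cast_L P
  have hε : 0 < P.eps := P.eps_pos
  set n : ℝ := (P.L : ℝ) ^ k with hndef
  have hn : 0 < n := pow_pos hLpos k
  have hnnat : ((P.L ^ k : ℕ) : ℝ) = n := by push_cast; rw [hndef]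
  have hsp : P.spacing k = n * P.eps := rfl
  have hsp0 : 0 < P.spacing k := P.spacing_pos k
  have hα : 0 < B1RG242Torus.α P a k := mul_pos (B1.aSeq_pos ha hL1 hk1) (inv_pos.2 (pow_pos hsp0 2))
  have hαa : B1RG242Torus.α P a k * P.spacing k ^ 2 ≤ a := by
    show B1.aSeq a P.L k * (P.spacing k ^ 2)⁻¹ * P.spacing k ^ 2 ≤ a
    rw [inv_mul_cancel_right₀ (pow_ne_zero 2 hsp0.ne')]
    exact B1.aSeq_le ha hL1 k hk1
  set a' : ℝ := B1RG242Torus.α P a k * (P.L : ℝ) ^ (k * P.d) with ha'def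
  have ha' : 0 < a' := mul_pos hα (pow_pos hLpos _)
  have hc' : P.eps⁻¹ ≠ 0 := inv_ne_zero hε.ne'
  -- the plaquette hypothesis in the two languages
  have hθ0 : 0 ≤ θ := by
    have h := hθ x₀ i i
    rw [plaqC_self, sub_self, norm_zero] at h
    exact h
  have hplaq : ∀ p : Balaban1983to89.Plaq P 0, dist1 (plaqHol U p) ≤ θ := dist1_plaqHol_le_of_plaqC U hθ
  set v : Balaban1983to89.Site P 0 → ℂ := gBox a' P.eps⁻¹ U k B *ᵥ f - gBox a' P.eps⁻¹ U k Ω *ᵥ f with hvdef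
  -- the pair distance and the radius
  set ρ : ℕ := supDist x₀ x₁ with hρdef
  have hρ0 : (0 : ℝ) < ρ := by exact_mod_cast hρ1
  have hρn : 64 * (ρ : ℝ) ≤ n := by rw [← hnnat]; exact_mod_cast hρ64
  have h64 : 64 ≤ P.L ^ k := le_trans (by omega) hρ64
  set r : ℕ := P.L ^ k / 8 with hrdef
  have hr8 : 8 * r ≤ P.L ^ k := Nat.mul_div_le (P.L ^ k) 8
  have hr8' : P.L ^ k < 8 * (r + 1) := by rw [hrdef]; omega
  have hrn : 8 * (r : ℝ) ≤ n := by rw [← hnnat]; exact_mod_cast hr8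
  have hrn' : n ≤ 8 * r + 8 := by
    have h : ((P.L ^ k : ℕ) : ℝ) ≤ ((8 * (r + 1) : ℕ) : ℝ) := by exact_mod_cast hr8'.le
    rw [hnnat] at h; push_cast at h; linarith
  have hρ1' : (1 : ℝ) ≤ ρ := by exact_mod_cast hρ1
  have hn1 : (1 : ℝ) ≤ n := by linarith
  have hr7 : (7 : ℝ) ≤ r := by linarith
  have hr4 : 4 ≤ r := by exact_mod_cast (show (4 : ℝ) ≤ r by linarith)
  have hr0 : (0 : ℝ) < r := by linarith
  have hr16 : n ≤ 16 * r := by linarith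
  have hrle : (r : ℝ) ≤ n := by linarith
  have hρr : 2 * ρ + 4 ≤ r := by
    have h1 : 2 * (ρ : ℝ) + 4 ≤ r := by linarith
    exact_mod_cast h1
  have hN' : 4 * r + 6 ≤ P.sitesPerDir 0 := by
    have h1 := two_mul_pow_le_sitesPerDir (P := P) hk
    omega
  have hRb : 2 * (2 * r) + 4 < P.sitesPerDir 0 := by omega
  -- the `(2r+1)`-ball lies in `□`
  have hinQ : ∀ w, supDist x₀ w ≤ 2 * r + 1 → w ∈ B := ball_subset_of_deep h64 hdeep
  ----------------------------------------------------------------------------------------------------------------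
  -- the gauge
  set hg := centredGaugeDir U x₀ (2 * r) i with hhg
  set U' := gaugeAct hg U with hU'
  set ψ : Balaban1983to89.Site P 0 → ℂ := fun z => toC (hg z) * v z with hψdef
  -- the torus source of the gauge copy VANISHES on the `2r`-ball
  set f' : Balaban1983to89.Site P 0 → ℂ := nOp a' P.eps⁻¹ U' k univ *ᵥ ψ with hf'def
  have hψeq : nOp a' P.eps⁻¹ U' k univ *ᵥ ψ = f' := rfl
  have hf'z : ∀ z, supDist x₀ z ≤ 2 * r → f' z = 0 := by
    intro z hz
    have hzQ : z ∈ B := hinQ z (by omega)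
    have hs : ∀ ν, z.shift ν ∈ B := fun ν => hinQ _ ((supDist_shift_le_succ x₀ z ν).trans (by omega))
    have hu : ∀ ν, z.unshift ν ∈ B := fun ν => hinQ _ ((supDist_unshift_le_succ x₀ z ν).trans (by omega))
    exact harmonic_gauged_on_interior hk0 hc' ha' hg U hB hΩ hsub f hzQ hs hu
  have hnormψ : ∀ z, ‖ψ z‖ = ‖v z‖ := fun z => by simp only [hψdef]; rw [norm_mul, norm_toC, one_mul]
  have hcov : ∀ z ν, ‖cfg U' ⟨z, ν⟩ * ψ (z.shift ν) - ψ z‖ = ‖cfg U ⟨z, ν⟩ * v (z.shift ν) - v z‖ := fun z ν =>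
    norm_covDiff_gaugeAct hg U v z ν
  set γ : ℝ := ((P.d - 1 : ℕ) : ℝ) * θ with hγdef
  have hγ0 : 0 ≤ γ := by positivity
  have hγn : γ * n ^ 2 ≤ 1 := gamma_nsq_le_one hθ0 hd1' hsmall
  have hgauge : ∀ z ν, supDist x₀ z ≤ 2 * r → ‖cfg U' ⟨z, ν⟩ - 1‖ ≤ γ * ((min (supDist x₀ z) (supDist x₁ z) : ℕ) : ℝ) := by
    intro z ν hz
    have h1 := dist1_centredGaugeDir_le_min U hθ0 hplaq x₀ hRb i hx₁ z hz ν
    rw [BIJ88Smooth43Axial.dist1_eq_norm_toC_sub_one] at h1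
    calc ‖cfg U' ⟨z, ν⟩ - 1‖ = ‖toC (gaugeAct hg U ⟨z, ν⟩) - 1‖ := rfl
      _ ≤ ((P.d - 1 : ℕ) : ℝ) * ((min (supDist x₀ z) (supDist x₁ z) : ℕ) : ℝ) * θ := h1
      _ = γ * ((min (supDist x₀ z) (supDist x₁ z) : ℕ) : ℝ) := by rw [hγdef]; ring
  -- the axis bonds are trivial
  have haxis : ∀ (z : Balaban1983to89.Site P 0) (μ' : Fin P.d), (∀ ν, ν ≠ i → z ν = x₀ ν) → supDist x₀ z ≤ ρ →
      cfg U' ⟨z, μ'⟩ = 1 := by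
    intro z μ' hz hzρ
    have hz2 : supDist x₀ z ≤ 2 * r := by omega
    have h1 := dist1_centredGaugeDir_le U hθ0 hplaq x₀ hRb i z hz2 μ' (n := 0) (fun ν hν => by
      rw [hz ν hν, sub_self]; exact le_of_eq ((B3TorusRadialSums.cdist_eq_zero_iff _).2 rfl))
    rw [Nat.cast_zero, mul_zero, zero_mul, BIJ88Smooth43Axial.dist1_eq_norm_toC_sub_one] at h1
    exact sub_eq_zero.1 (norm_le_zero_iff.1 h1)
  refine ⟨haxis, ?_⟩
  ----------------------------------------------------------------------------------------------------------------
  -- the local data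
  have hSψ : ∀ z, supDist x₀ z ≤ 2 * r + P.L ^ k + 1 → ‖ψ z‖ ≤ S := fun z hz => by rw [hnormψ]; exact hSv z hz
  have hMψ : ∀ z ν, supDist x₀ z ≤ 2 * r → ‖cfg U' ⟨z, ν⟩ * ψ (z.shift ν) - ψ z‖ ≤ Mloc := fun z ν hz => by
    rw [hcov]; exact hMv z ν hz
  have hFf' : ∀ z, supDist x₀ z ≤ 2 * r → ‖f' z‖ ≤ 0 := fun z hz => by rw [hf'z z hz, norm_zero]
  -- the Hölder envelopes of the difference kernel
  have hPdR : (P.d : ℝ) = (d : ℝ) := by rw [hPd]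
  set A : ℝ := C_H * P.eps ^ 2 * (ρ : ℝ) ^ α with hAdef
  have hA0 : 0 ≤ A := by positivity
  have hK1 : ∀ z, |((B1RG242Torus.tower P a 0).G k (x₁.shift μ) z - (B1RG242Torus.tower P a 0).G k x₁ z) -
      ((B1RG242Torus.tower P a 0).G k (x₀.shift μ) z - (B1RG242Torus.tower P a 0).G k x₀ z)| ≤
      A / (max ((min (supDist x₀ z) (supDist x₁ z) : ℕ) : ℝ) 1) ^ ((P.d : ℝ) - 1 + α) := fun z => by
    rw [hAdef, hPdR]; exact hholP.1 μ x₀ x₁ z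
  have hK2 : ∀ (ν : Fin P.d) z,
      |(((B1RG242Torus.tower P a 0).G k (x₁.shift μ) (z.shift ν) - (B1RG242Torus.tower P a 0).G k x₁ (z.shift ν)) -
          ((B1RG242Torus.tower P a 0).G k (x₀.shift μ) (z.shift ν) - (B1RG242Torus.tower P a 0).G k x₀ (z.shift ν))) -
        (((B1RG242Torus.tower P a 0).G k (x₁.shift μ) z - (B1RG242Torus.tower P a 0).G k x₁ z) -
          ((B1RG242Torus.tower P a 0).G k (x₀.shift μ) z - (B1RG242Torus.tower P a 0).G k x₀ z))| ≤
      A / (max ((min (supDist x₀ z) (supDist x₁ z) : ℕ) : ℝ) 1) ^ ((P.d : ℝ) + α) := fun ν z => by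
    have h := hholP.2 μ ν x₀ x₁ z
    rw [hAdef, hPdR]
    refine le_trans (le_of_eq ?_) h
    congr 1; ring
  -- THE LOCAL ESTIMATE
  have hmain := hloc P hPd ha hk1 hkK hr4 hN' x₀ x₁ μ hρr U' ψ f' hψeq hA0 hγ0 hS0 hMloc0 le_rfl hK1 hK2 hgauge hSψ hMψ hFf'
  -- its left-hand side is the target quantity
  have hLHS : (toC (hg (x₁.shift μ)) * v (x₁.shift μ) - toC (hg x₁) * v x₁) - (toC (hg (x₀.shift μ)) * v (x₀.shift μ) - toC (hg x₀) * v x₀) =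
      (ψ (x₁.shift μ) - ψ x₁) - (ψ (x₀.shift μ) - ψ x₀) := rfl
  rw [hLHS]
  refine hmain.trans ?_
  ----------------------------------------------------------------------------------------------------------------
  -- the powers
  set Pw : ℝ := (r : ℝ) ^ (1 - α) with hPw
  set Qw : ℝ := ((r : ℝ) + (P.L : ℝ) ^ k) ^ (1 - α) with hQw
  set W : ℝ := ((ρ : ℝ) / n) ^ α with hWdef
  set Sn : ℝ := S / n with hSndef
  have hSn0 : 0 ≤ Sn := div_nonneg hS0 hn.le
  have hSeq : S = Sn * n := by rw [hSndef]; field_simp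
  have h1α : 0 ≤ 1 - α := by linarith
  have hρα : 0 ≤ (ρ : ℝ) ^ α := Real.rpow_nonneg hρ0.le α
  have hnα : 0 < n ^ (1 - α) := Real.rpow_pos_of_pos hn _
  have hnα' : 0 < n ^ (-α) := Real.rpow_pos_of_pos hn _
  have hW0 : 0 ≤ W := Real.rpow_nonneg (div_nonneg hρ0.le hn.le) α
  have hWeq : (ρ : ℝ) ^ α * n ^ (-α) = W := by
    rw [hWdef, Real.div_rpow hρ0.le hn.le, Real.rpow_neg hn.le, div_eq_mul_inv]
  have p1 : Pw ≤ n ^ (1 - α) := Real.rpow_le_rpow hr0.le hrle h1α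
  have p2 : Qw ≤ 2 * n ^ (1 - α) := by
    rw [hQw, ← hndef]
    exact rpow_le_mul_rpow (by norm_num) (by positivity) hn.le (by linarith) h1α (by linarith)
  have p3 : (r : ℝ) ^ (-α) ≤ 16 * n ^ (-α) := rpow_neg_le_of_le_mul hr0 hn hr16 hα0 hα1.le
  have p4 : n ^ (1 - α) = n ^ (-α) * n := by
    rw [show (1 : ℝ) - α = -α + 1 by ring, Real.rpow_add hn, Real.rpow_one]
  -- the four surviving terms
  have q1 : (0 : ℝ) * A * Pw = 0 := by ring
  have q2 : P.eps⁻¹ ^ 2 * (γ * A * (r * Pw * Mloc)) ≤ C_H * (W * Mloc) := by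
    have e1 : P.eps⁻¹ ^ 2 * (γ * A * (r * Pw * Mloc)) = C_H * ((ρ : ℝ) ^ α * (γ * (r * Pw))) * Mloc := by
      rw [hAdef]; field_simp
    rw [e1]
    have h1 : γ * (r * Pw) ≤ n ^ (-α) := by
      calc γ * (r * Pw) ≤ γ * (n * n ^ (1 - α)) := by gcongr
        _ = γ * n ^ 2 * n ^ (-α) := by rw [p4]; ring
        _ ≤ 1 * n ^ (-α) := mul_le_mul_of_nonneg_right hγn hnα'.le
        _ = n ^ (-α) := one_mul _
    have h2 : (ρ : ℝ) ^ α * (γ * (r * Pw)) ≤ W := by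
      calc (ρ : ℝ) ^ α * (γ * (r * Pw)) ≤ (ρ : ℝ) ^ α * n ^ (-α) := mul_le_mul_of_nonneg_left h1 hρα
        _ = W := hWeq
    calc C_H * ((ρ : ℝ) ^ α * (γ * (r * Pw))) * Mloc ≤ C_H * W * Mloc := by gcongr
      _ = C_H * (W * Mloc) := by ring
  have q3 : P.eps⁻¹ ^ 2 * (γ * A * (Pw * S)) ≤ C_H * (W * Sn) := by
    have e1 : P.eps⁻¹ ^ 2 * (γ * A * (Pw * S)) = C_H * ((ρ : ℝ) ^ α * (γ * n * Pw)) * Sn := by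
      rw [hAdef, hSeq]; field_simp
    rw [e1]
    have h1 : γ * n * Pw ≤ n ^ (-α) := by
      calc γ * n * Pw ≤ γ * n * n ^ (1 - α) := by gcongr
        _ = γ * n ^ 2 * n ^ (-α) := by rw [p4]; ring
        _ ≤ 1 * n ^ (-α) := mul_le_mul_of_nonneg_right hγn hnα'.le
        _ = n ^ (-α) := one_mul _
    have h2 : (ρ : ℝ) ^ α * (γ * n * Pw) ≤ W := by
      calc (ρ : ℝ) ^ α * (γ * n * Pw) ≤ (ρ : ℝ) ^ α * n ^ (-α) := mul_le_mul_of_nonneg_left h1 hρα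
        _ = W := hWeq
    calc C_H * ((ρ : ℝ) ^ α * (γ * n * Pw)) * Sn ≤ C_H * W * Sn := by gcongr
      _ = C_H * (W * Sn) := by ring
  have q4 : P.eps⁻¹ ^ 2 * (A * S * ((r : ℝ) ^ (-α) / r)) ≤ 256 * C_H * (W * Sn) := by
    have e1 : P.eps⁻¹ ^ 2 * (A * S * ((r : ℝ) ^ (-α) / r)) = C_H * ((ρ : ℝ) ^ α * ((r : ℝ) ^ (-α) * (n / r))) * Sn := by
      rw [hAdef, hSeq]; field_simp
    rw [e1]
    have h1 : n / r ≤ 16 := by rw [div_le_iff₀ hr0]; linarith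
    have h2 : (r : ℝ) ^ (-α) * (n / r) ≤ (16 * n ^ (-α)) * 16 := mul_le_mul p3 h1 (by positivity) (by positivity)
    have h3 : (ρ : ℝ) ^ α * ((r : ℝ) ^ (-α) * (n / r)) ≤ 256 * W := by
      calc (ρ : ℝ) ^ α * ((r : ℝ) ^ (-α) * (n / r)) ≤ (ρ : ℝ) ^ α * ((16 * n ^ (-α)) * 16) := mul_le_mul_of_nonneg_left h2 hρα
        _ = 256 * ((ρ : ℝ) ^ α * n ^ (-α)) := by ring
        _ = 256 * W := by rw [hWeq]
    calc C_H * ((ρ : ℝ) ^ α * ((r : ℝ) ^ (-α) * (n / r))) * Sn ≤ C_H * (256 * W) * Sn := by gcongr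
      _ = 256 * C_H * (W * Sn) := by ring
  have q5 : B1RG242Torus.α P a k * A * Qw * S ≤ 2 * a * C_H * (W * Sn) := by
    have e1 : B1RG242Torus.α P a k * A * Qw * S =
        C_H * ((B1RG242Torus.α P a k * P.spacing k ^ 2) * ((ρ : ℝ) ^ α * (Qw / n))) * Sn := by
      rw [hAdef, hSeq, hsp]; field_simp
    rw [e1]
    have h1 : Qw / n ≤ 2 * n ^ (-α) := by
      rw [div_le_iff₀ hn]
      calc Qw ≤ 2 * n ^ (1 - α) := p2
        _ = 2 * n ^ (-α) * n := by rw [p4]; ring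
    have h2 : (B1RG242Torus.α P a k * P.spacing k ^ 2) * ((ρ : ℝ) ^ α * (Qw / n)) ≤ a * (2 * W) := by
      refine mul_le_mul hαa ?_ (by positivity) ha.le
      calc (ρ : ℝ) ^ α * (Qw / n) ≤ (ρ : ℝ) ^ α * (2 * n ^ (-α)) := mul_le_mul_of_nonneg_left h1 hρα
        _ = 2 * ((ρ : ℝ) ^ α * n ^ (-α)) := by ring
        _ = 2 * W := by rw [hWeq]
    calc C_H * ((B1RG242Torus.α P a k * P.spacing k ^ 2) * ((ρ : ℝ) ^ α * (Qw / n))) * Sn ≤ C_H * (a * (2 * W)) * Sn := by gcongr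
      _ = 2 * a * C_H * (W * Sn) := by ring
  have hsum : 0 * A * Pw + P.eps⁻¹ ^ 2 * (γ * A * (r * Pw * Mloc + Pw * S) + A * S * ((r : ℝ) ^ (-α) / r)) +
      B1RG242Torus.α P a k * A * Qw * S ≤ (C_H * (257 + 2 * a)) * (W * (Mloc + Sn)) := by
    have e1 : P.eps⁻¹ ^ 2 * (γ * A * (r * Pw * Mloc + Pw * S) + A * S * ((r : ℝ) ^ (-α) / r)) =
        P.eps⁻¹ ^ 2 * (γ * A * (r * Pw * Mloc)) + P.eps⁻¹ ^ 2 * (γ * A * (Pw * S)) + P.eps⁻¹ ^ 2 * (A * S * ((r : ℝ) ^ (-α) / r)) := by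
      ring
    rw [e1, q1]
    have hWM : 0 ≤ C_H * (W * Mloc) := mul_nonneg hCH.le (mul_nonneg hW0 hMloc0)
    have hWMa : 0 ≤ a * (C_H * (W * Mloc)) := mul_nonneg ha.le hWM
    nlinarith only [q2, q3, q4, q5, hWM, hWMa]
  have hunit : 0 ≤ W * (Mloc + Sn) := mul_nonneg hW0 (add_nonneg hMloc0 hSn0)
  calc C_L * (0 * A * Pw + P.eps⁻¹ ^ 2 * (γ * A * (r * Pw * Mloc + Pw * S) + A * S * ((r : ℝ) ^ (-α) / r)) +
        B1RG242Torus.α P a k * A * Qw * S)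
      ≤ C_L * ((C_H * (257 + 2 * a)) * (W * (Mloc + Sn))) := mul_le_mul_of_nonneg_left hsum hCL.le
    _ = K₁ * (W * (Mloc + Sn)) := by rw [hK₁]; ring
    _ ≤ (K₁ + 1) * (W * (Mloc + Sn)) := by nlinarith only [hunit]
    _ = (K₁ + 1) * W * (Mloc + Sn) := by ring

end Leg

/-! ## §3 The gauge-invariant form of the leg estimate -/

section LegInv

/-- **THE HÖLDER LEG ESTIMATE FOR `v = G_k(□,u)f − G_k(Ω,u)f` AT AN AXIS-PARALLEL DEEP PAIR, GAUGE-INVARIANT FORM, ABSTRACT LOCAL DATA** —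
under the hypotheses of `closeHolder_leg_gauged`, for every site `x` `L^k`-deep in `□`, directions `i, μ`, every `1 ≤ ρ ≤ L^k/64`, with
`x′ = x + ρe_i` and `Γ = [x, x′]` the straight segment (p30's `axisHol`):
`‖U(Γ)·(D_uv)(⟨x′, μ⟩) − (D_uv)(⟨x, μ⟩)‖ ≤ c₀(ρ/L^k)^α·ε⁻¹(M_loc + S/L^k)` — in the axis-rooted gauge the transport is `1` and the covariant
derivatives are plain differences divided by `ε` (§2), and the three factors are gauge covariant (p30's `axisHol_gaugeAct`, `covD_gaugeAct`;
p30's `holder19_leg` / p27's `holder19_cube_leg` proof verbatim).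
[cite: Balaban1983RegularityDecay, Theorem p.573 (1.9), (1.11)–(1.12)] [cite: BalabanImbrieJaffe1985, (2.7) p.303, (7.3.1) p.326] [cite: BalabanImbrieJaffe1988, p.263, (2.31)] -/
theorem closeHolder_leg (d L : ℕ) (hd2 : 2 ≤ d) (hL : Odd L ∧ 1 < L) {a : ℝ} (ha : 0 < a) {α : ℝ} (hα0 : 0 ≤ α) (hα1 : α < 1) :
    ∃ c₀ : ℝ, 0 < c₀ ∧ ∀ (P : Params), P.d = d → P.L = L → ∀ k : ℕ, 1 ≤ k → k ≤ P.K →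
      ∀ (B Ω : Finset (Balaban1983to89.Site P 0)), IsBlockUnion k B → IsBlockUnion k Ω → B ⊆ Ω →
      ∀ (U : GaugeField P 0 U1) (θ : ℝ), (∀ (y : Balaban1983to89.Site P 0) (μ ν : Fin P.d), ‖plaqC U y μ ν - 1‖ ≤ θ) →
        2 * (P.d : ℝ) ^ 3 * (((P.L : ℝ) ^ k) ^ 2 * θ) ^ 2 ≤ 1 →
      ∀ (x : Balaban1983to89.Site P 0) (i μ : Fin P.d) (ρ : ℕ), 1 ≤ ρ → 64 * ρ ≤ P.L ^ k →
        (∀ w, w ∉ B → P.L ^ k ≤ supDist x w) →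
      ∀ (f : Balaban1983to89.Site P 0 → ℂ) (S Mloc : ℝ), 0 ≤ S → 0 ≤ Mloc →
        (∀ z, supDist x z ≤ 2 * (P.L ^ k / 8) + P.L ^ k + 1 →
          ‖(gBox (B1RG242Torus.α P a k * (P.L : ℝ) ^ (k * P.d)) P.eps⁻¹ U k B *ᵥ f -
              gBox (B1RG242Torus.α P a k * (P.L : ℝ) ^ (k * P.d)) P.eps⁻¹ U k Ω *ᵥ f) z‖ ≤ S) →
        (∀ z ν, supDist x z ≤ 2 * (P.L ^ k / 8) →
          ‖cfg U ⟨z, ν⟩ * (gBox (B1RG242Torus.α P a k * (P.L : ℝ) ^ (k * P.d)) P.eps⁻¹ U k B *ᵥ f -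
                gBox (B1RG242Torus.α P a k * (P.L : ℝ) ^ (k * P.d)) P.eps⁻¹ U k Ω *ᵥ f) (z.shift ν) -
              (gBox (B1RG242Torus.α P a k * (P.L : ℝ) ^ (k * P.d)) P.eps⁻¹ U k B *ᵥ f -
                gBox (B1RG242Torus.α P a k * (P.L : ℝ) ^ (k * P.d)) P.eps⁻¹ U k Ω *ᵥ f) z‖ ≤ Mloc) →
        ‖toC (axisHol U i ρ x) *
              covD P.eps⁻¹ (cfg U) (gBox (B1RG242Torus.α P a k * (P.L : ℝ) ^ (k * P.d)) P.eps⁻¹ U k B *ᵥ f -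
                gBox (B1RG242Torus.α P a k * (P.L : ℝ) ^ (k * P.d)) P.eps⁻¹ U k Ω *ᵥ f) ⟨runSite x i ρ, μ⟩ -
            covD P.eps⁻¹ (cfg U) (gBox (B1RG242Torus.α P a k * (P.L : ℝ) ^ (k * P.d)) P.eps⁻¹ U k B *ᵥ f -
                gBox (B1RG242Torus.α P a k * (P.L : ℝ) ^ (k * P.d)) P.eps⁻¹ U k Ω *ᵥ f) ⟨x, μ⟩‖
          ≤ c₀ * ((ρ : ℝ) / (P.L : ℝ) ^ k) ^ α * (P.eps⁻¹ * (Mloc + S / (P.L : ℝ) ^ k)) := by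
  obtain ⟨c₀, hc₀, hleg⟩ := closeHolder_leg_gauged d L hd2 hL ha hα0 hα1
  refine ⟨c₀, hc₀, ?_⟩
  intro P hPd hPL k hk1 hkK B Ω hB hΩ hsub U θ hθ hsmall x i μ ρ hρ1 hρ64 hdeep f S Mloc hS0 hMloc0 hSv hMv
  have hk : k ≤ P.m + P.K := hkK.trans (Nat.le_add_left _ _)
  have hNN : 2 * P.L ^ k ≤ P.sitesPerDir 0 := two_mul_pow_le_sitesPerDir (P := P) hk
  set x₁ := runSite x i ρ with hx₁
  have hax : ∀ ν, ν ≠ i → x₁ ν = x ν := fun ν hν => runSite_apply_ne x hν ρ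
  have hdist : supDist x x₁ = ρ := supDist_runSite_eq x i (by omega)
  have h1 : 1 ≤ supDist x x₁ := by rw [hdist]; exact hρ1
  have h64 : 64 * supDist x x₁ ≤ P.L ^ k := by rw [hdist]; exact hρ64
  obtain ⟨haxis, hest⟩ := hleg P hPd hPL k hk1 hkK B Ω hB hΩ hsub U θ hθ hsmall x x₁ i μ hax h1 h64 hdeep f S Mloc hS0 hMloc0 hSv hMv
  rw [hdist] at hest
  set v : Balaban1983to89.Site P 0 → ℂ := gBox (B1RG242Torus.α P a k * (P.L : ℝ) ^ (k * P.d)) P.eps⁻¹ U k B *ᵥ f -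
    gBox (B1RG242Torus.α P a k * (P.L : ℝ) ^ (k * P.d)) P.eps⁻¹ U k Ω *ᵥ f with hv
  set hg := centredGaugeDir U x (2 * (P.L ^ k / 8)) i with hhg
  set U' := gaugeAct hg U with hU'
  set ψ : Balaban1983to89.Site P 0 → ℂ := fun z => toC (hg z) * v z with hψ
  -- the transport and the two bond variables are trivial in the gauge
  have hseg : ∀ s, s < ρ → cfg U' ⟨runSite x i s, i⟩ = 1 := fun s hs =>
    haxis (runSite x i s) i (fun ν hν => runSite_apply_ne x hν s) (by rw [hdist]; exact (supDist_runSite_le x i s).trans hs.le)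
  have hA' : toC (axisHol U' i ρ x) = 1 := toC_axisHol_eq_one U' i ρ x hseg
  have hu0 : cfg U' ⟨x, μ⟩ = 1 := haxis x μ (fun _ _ => rfl) (by rw [(supDist_eq_zero_iff x x).2 rfl]; exact Nat.zero_le _)
  have hu1 : cfg U' ⟨x₁, μ⟩ = 1 := haxis x₁ μ hax le_rfl
  -- gauge covariance of the three factors
  have hAg : toC (axisHol U' i ρ x) = toC (hg x) * toC (axisHol U i ρ x) * conj (toC (hg x₁)) := by
    rw [hU', axisHol_gaugeAct, toC_mul, toC_mul, toC_inv]
  have hD0 : covD P.eps⁻¹ (cfg U') ψ ⟨x, μ⟩ = toC (hg x) * covD P.eps⁻¹ (cfg U) v ⟨x, μ⟩ := covD_gaugeAct _ hg U v _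
  have hD1 : covD P.eps⁻¹ (cfg U') ψ ⟨x₁, μ⟩ = toC (hg x₁) * covD P.eps⁻¹ (cfg U) v ⟨x₁, μ⟩ := covD_gaugeAct _ hg U v _
  -- the invariant quantity in the gauge
  have hkey : toC (hg x) * (toC (axisHol U i ρ x) * covD P.eps⁻¹ (cfg U) v ⟨x₁, μ⟩ - covD P.eps⁻¹ (cfg U) v ⟨x, μ⟩) =
      toC (axisHol U' i ρ x) * covD P.eps⁻¹ (cfg U') ψ ⟨x₁, μ⟩ - covD P.eps⁻¹ (cfg U') ψ ⟨x, μ⟩ := by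
    rw [hAg, hD0, hD1]
    have h1 : conj (toC (hg x₁)) * toC (hg x₁) = 1 := conj_mul_toC _
    linear_combination (-(toC (hg x) * toC (axisHol U i ρ x) * covD P.eps⁻¹ (cfg U) v ⟨x₁, μ⟩)) * h1
  -- in the gauge: plain second difference divided by `ε`
  have hgauged : toC (axisHol U' i ρ x) * covD P.eps⁻¹ (cfg U') ψ ⟨x₁, μ⟩ - covD P.eps⁻¹ (cfg U') ψ ⟨x, μ⟩ =
      ((P.eps⁻¹ : ℝ) : ℂ) * ((ψ (x₁.shift μ) - ψ x₁) - (ψ (x.shift μ) - ψ x)) := by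
    rw [hA', one_mul]
    simp only [covD, hu0, hu1, one_mul]
    show ((P.eps⁻¹ : ℝ) : ℂ) * (ψ (x₁.shift μ) - ψ x₁) - ((P.eps⁻¹ : ℝ) : ℂ) * (ψ (x.shift μ) - ψ x) = _
    ring
  have hnorm : ‖toC (axisHol U i ρ x) * covD P.eps⁻¹ (cfg U) v ⟨x₁, μ⟩ - covD P.eps⁻¹ (cfg U) v ⟨x, μ⟩‖ =
      P.eps⁻¹ * ‖(ψ (x₁.shift μ) - ψ x₁) - (ψ (x.shift μ) - ψ x)‖ := by
    have h1 : ‖toC (hg x) * (toC (axisHol U i ρ x) * covD P.eps⁻¹ (cfg U) v ⟨x₁, μ⟩ - covD P.eps⁻¹ (cfg U) v ⟨x, μ⟩)‖ =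
        ‖toC (axisHol U i ρ x) * covD P.eps⁻¹ (cfg U) v ⟨x₁, μ⟩ - covD P.eps⁻¹ (cfg U) v ⟨x, μ⟩‖ := by
      rw [norm_mul, norm_toC, one_mul]
    rw [← h1, hkey, hgauged, norm_mul, Complex.norm_real, Real.norm_of_nonneg (inv_nonneg.2 P.eps_pos.le)]
  rw [hnorm]
  calc P.eps⁻¹ * ‖(ψ (x₁.shift μ) - ψ x₁) - (ψ (x.shift μ) - ψ x)‖
      ≤ P.eps⁻¹ * (c₀ * ((ρ : ℝ) / (P.L : ℝ) ^ k) ^ α * (Mloc + S / (P.L : ℝ) ^ k)) :=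
        mul_le_mul_of_nonneg_left hest (inv_nonneg.2 P.eps_pos.le)
    _ = c₀ * ((ρ : ℝ) / (P.L : ℝ) ^ k) ^ α * (P.eps⁻¹ * (Mloc + S / (P.L : ℝ) ^ k)) := by ring

end LegInv

/-! ## §4 ALL DEEP PAIRS from local data: the staircase (near pairs) and the two covariant derivatives (far pairs) -/

section AllPairs

/-- kernel: the norm of the level-`k` covariant derivative is `ε⁻¹` times the norm of the covariant difference (p30's
`BIJ88NeumannPropagatorSmallFieldCloseDeriv.norm_covD_apply`, private copy). [cite: BalabanImbrieJaffe1985, (2.3) p.302, (2.7) p.303] -/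
private theorem norm_covD_eq (U : GaugeField P 0 U1) (φ : Balaban1983to89.Site P 0 → ℂ) (z : Balaban1983to89.Site P 0) (ν : Fin P.d) :
    ‖covD P.eps⁻¹ (cfg U) φ ⟨z, ν⟩‖ = P.eps⁻¹ * ‖cfg U ⟨z, ν⟩ * φ (z.shift ν) - φ z‖ := by
  show ‖((P.eps⁻¹ : ℝ) : ℂ) * (cfg U ⟨z, ν⟩ * φ (z.shift ν) - φ z)‖ = _
  rw [norm_mul, Complex.norm_real, Real.norm_of_nonneg (inv_nonneg.2 P.eps_pos.le)]

/-- kernel: the covariant derivative is linear — `D_u(φ − φ′) = D_uφ − D_uφ′` at every bond (p30's `covD_sub_covD`, private copy).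
[cite: BalabanImbrieJaffe1985, (2.3) p.302] -/
private theorem covD_sub (c : ℝ) (u : PBond P 0 → ℂ) (φ φ' : Balaban1983to89.Site P 0 → ℂ) (x : Balaban1983to89.Site P 0)
    (μ : Fin P.d) : covD c u (φ - φ') ⟨x, μ⟩ = covD c u φ ⟨x, μ⟩ - covD c u φ' ⟨x, μ⟩ := by
  simp only [covD, Pi.sub_apply]
  ring

set_option maxHeartbeats 400000 in
/-- **THE HÖLDER QUOTIENT OF `D_uv`, `v = G_k(□,u)f − G_k(Ω,u)f`, AT ALL DEEP PAIRS, FROM LOCAL DATA NEAR THE PAIR** — for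
[Balaban1983RegularityDecay] Theorem p. 573 (1.11)–(1.12) *"(with the same restrictions on x, x′)"* applied to the Hölder member (1.9)
*"1/|x − x′|^α |U(A(Γ_{x,x′}))(D^η_{A,μ}G_k(Ω,A)f)(x′) − (D^η_{A,μ}G_k(Ω,A)f)(x)| ≦ … for x, x′ ∈ Ω … dist({x,x′},Ω^c) ≧ R₀"*: for
`P.d = d ≥ 2`, `L` odd `> 1`, `a > 0`, `0 ≤ α < 1` there is `c₁ > 0` (on `d, L, a, α`) such that for every volume, `1 ≤ k ≤ K`, nested
`k`-block unions `□ ⊆ Ω`, every `U(1)` field with all oriented plaquettes within `θ` of `1`, `2d³(L^{2k}θ)² ≤ 1`, every pair of distinct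
sites `x₀, x₁` BOTH `2L^k`-deep in `□`, every direction `μ`, every `f`, and all reals `S ≥ ‖v(z)‖` on `{z : min(|x₀−z|_∞,|x₁−z|_∞) ≤ 2L^k}`,
`M_loc ≥ ‖u_{⟨z,ν⟩}v(z+e_ν) − v(z)‖` on `{z : min(|x₀−z|_∞,|x₁−z|_∞) ≤ L^k}`:
`(L^k/|x₀−x₁|_∞)^α·‖U(Γ_{x₀,x₁})(D_uv)(⟨x₁,μ⟩) − (D_uv)(⟨x₀,μ⟩)‖ ≤ c₁·ε⁻¹(M_loc + S/L^k)`, `Γ_{x₀,x₁}` p30's shortest staircase (`stairHol`).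
Near pairs (`64|x₀−x₁|_∞ ≤ L^k`): `d` axis-parallel legs (§3 at every corner, which is within `|x₀−x₁|_∞` of `x₀`) telescoped
(`stair_telescope`); far pairs: `‖D_uv‖ ≤ ε⁻¹M_loc` at both bonds and `(L^k/|x₀−x₁|)^α ≤ 64`.
[cite: Balaban1983RegularityDecay, Theorem p.573 (1.9), (1.11)–(1.12)] [cite: BalabanImbrieJaffe1985, (7.3.1) p.326] [cite: BalabanImbrieJaffe1988, p.263, (2.31)] -/
theorem closeHolder_of_local (d L : ℕ) (hd2 : 2 ≤ d) (hL : Odd L ∧ 1 < L) {a : ℝ} (ha : 0 < a) {α : ℝ} (hα0 : 0 ≤ α) (hα1 : α < 1) :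
    ∃ c₁ : ℝ, 0 < c₁ ∧ ∀ (P : Params), P.d = d → P.L = L → ∀ k : ℕ, 1 ≤ k → k ≤ P.K →
      ∀ (B Ω : Finset (Balaban1983to89.Site P 0)), IsBlockUnion k B → IsBlockUnion k Ω → B ⊆ Ω →
      ∀ (U : GaugeField P 0 U1) (θ : ℝ), (∀ (y : Balaban1983to89.Site P 0) (μ ν : Fin P.d), ‖plaqC U y μ ν - 1‖ ≤ θ) →
        2 * (P.d : ℝ) ^ 3 * (((P.L : ℝ) ^ k) ^ 2 * θ) ^ 2 ≤ 1 →
      ∀ (x₀ x₁ : Balaban1983to89.Site P 0) (μ : Fin P.d), x₀ ≠ x₁ →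
        (∀ w, w ∉ B → 2 * P.L ^ k ≤ supDist x₀ w) → (∀ w, w ∉ B → 2 * P.L ^ k ≤ supDist x₁ w) →
      ∀ (f : Balaban1983to89.Site P 0 → ℂ) (S Mloc : ℝ), 0 ≤ S → 0 ≤ Mloc →
        (∀ z, min (supDist x₀ z) (supDist x₁ z) ≤ 2 * P.L ^ k →
          ‖(gBox (B1RG242Torus.α P a k * (P.L : ℝ) ^ (k * P.d)) P.eps⁻¹ U k B *ᵥ f -
              gBox (B1RG242Torus.α P a k * (P.L : ℝ) ^ (k * P.d)) P.eps⁻¹ U k Ω *ᵥ f) z‖ ≤ S) →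
        (∀ z ν, min (supDist x₀ z) (supDist x₁ z) ≤ P.L ^ k →
          ‖cfg U ⟨z, ν⟩ * (gBox (B1RG242Torus.α P a k * (P.L : ℝ) ^ (k * P.d)) P.eps⁻¹ U k B *ᵥ f -
                gBox (B1RG242Torus.α P a k * (P.L : ℝ) ^ (k * P.d)) P.eps⁻¹ U k Ω *ᵥ f) (z.shift ν) -
              (gBox (B1RG242Torus.α P a k * (P.L : ℝ) ^ (k * P.d)) P.eps⁻¹ U k B *ᵥ f -
                gBox (B1RG242Torus.α P a k * (P.L : ℝ) ^ (k * P.d)) P.eps⁻¹ U k Ω *ᵥ f) z‖ ≤ Mloc) →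
        ((P.L : ℝ) ^ k / (supDist x₀ x₁ : ℝ)) ^ α *
            ‖stairHol U x₀ x₁ *
                covD P.eps⁻¹ (cfg U) (gBox (B1RG242Torus.α P a k * (P.L : ℝ) ^ (k * P.d)) P.eps⁻¹ U k B *ᵥ f -
                  gBox (B1RG242Torus.α P a k * (P.L : ℝ) ^ (k * P.d)) P.eps⁻¹ U k Ω *ᵥ f) ⟨x₁, μ⟩ -
              covD P.eps⁻¹ (cfg U) (gBox (B1RG242Torus.α P a k * (P.L : ℝ) ^ (k * P.d)) P.eps⁻¹ U k B *ᵥ f -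
                  gBox (B1RG242Torus.α P a k * (P.L : ℝ) ^ (k * P.d)) P.eps⁻¹ U k Ω *ᵥ f) ⟨x₀, μ⟩‖
          ≤ c₁ * (P.eps⁻¹ * (Mloc + S / (P.L : ℝ) ^ k)) := by
  classical
  obtain ⟨c₀, hc₀, hleg⟩ := closeHolder_leg d L hd2 hL ha hα0 hα1
  set K : ℝ := (d : ℝ) * c₀ + 128 with hKdef
  refine ⟨K, by positivity, ?_⟩
  intro P hPd hPL k hk1 hkK B Ω hB hΩ hsub U θ hθ hsmall x₀ x₁ μ hne hdeep₀ hdeep₁ f S Mloc hS0 hMloc0 hSv hMv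
  have hlegP := hleg P hPd hPL k hk1 hkK B Ω hB hΩ hsub U θ hθ hsmall
  have hPdR : (P.d : ℝ) = (d : ℝ) := by rw [hPd]
  -- basic quantities
  have hLpos : (0 : ℝ) < P.L := P.cast_L_pos
  set n : ℝ := (P.L : ℝ) ^ k with hndef
  have hn : 0 < n := pow_pos hLpos k
  have hnnat : ((P.L ^ k : ℕ) : ℝ) = n := by push_cast; rw [hndef]
  have hε : 0 < P.eps := P.eps_pos
  set ρ : ℕ := supDist x₀ x₁ with hρdef
  have hρ1 : 1 ≤ ρ := by
    by_contra h
    push Not at h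
    exact hne ((supDist_eq_zero_iff x₀ x₁).1 (by omega))
  have hρ0 : (0 : ℝ) < ρ := by exact_mod_cast hρ1
  set v : Balaban1983to89.Site P 0 → ℂ := gBox (B1RG242Torus.α P a k * (P.L : ℝ) ^ (k * P.d)) P.eps⁻¹ U k B *ᵥ f -
    gBox (B1RG242Torus.α P a k * (P.L : ℝ) ^ (k * P.d)) P.eps⁻¹ U k Ω *ᵥ f with hv
  set X : Balaban1983to89.Site P 0 → ℂ := fun w => covD P.eps⁻¹ (cfg U) v ⟨w, μ⟩ with hX
  -- the local unit
  set M : ℝ := P.eps⁻¹ * (Mloc + S / n) with hMdef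
  have hSn0 : 0 ≤ S / n := div_nonneg hS0 hn.le
  have hM0 : 0 ≤ M := mul_nonneg (inv_nonneg.2 hε.le) (add_nonneg hMloc0 hSn0)
  have hMlocM : P.eps⁻¹ * Mloc ≤ M := by
    rw [hMdef]; exact mul_le_mul_of_nonneg_left (le_add_of_nonneg_right hSn0) (inv_nonneg.2 hε.le)
  -- the unit `W = (ρ/n)^α`
  set W : ℝ := ((ρ : ℝ) / n) ^ α with hWdef
  have hW0 : 0 < W := Real.rpow_pos_of_pos (div_pos hρ0 hn) α
  have hWinv : (n / (ρ : ℝ)) ^ α * W = 1 := by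
    rw [hWdef, ← Real.mul_rpow (by positivity) (by positivity), div_mul_div_comm, mul_comm n, div_self (by positivity), Real.one_rpow]
  have hK0 : 0 ≤ K := by positivity
  -- it suffices to bound the norm by `K·W·M`
  suffices hmain : ‖stairHol U x₀ x₁ * X x₁ - X x₀‖ ≤ K * W * M by
    have h1 : (n / (ρ : ℝ)) ^ α * ‖stairHol U x₀ x₁ * X x₁ - X x₀‖ ≤ (n / (ρ : ℝ)) ^ α * (K * W * M) :=
      mul_le_mul_of_nonneg_left hmain (Real.rpow_nonneg (by positivity) α)
    have h2 : (n / (ρ : ℝ)) ^ α * (K * W * M) = K * M := by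
      calc (n / (ρ : ℝ)) ^ α * (K * W * M) = ((n / (ρ : ℝ)) ^ α * W) * (K * M) := by ring
        _ = K * M := by rw [hWinv, one_mul]
    simpa [hX, hρdef, hMdef, hndef] using (h1.trans h2.le)
  -- the covariant derivatives at the two end points
  have hXle : ∀ {w : Balaban1983to89.Site P 0}, min (supDist x₀ w) (supDist x₁ w) ≤ P.L ^ k → ‖X w‖ ≤ M := by
    intro w hw
    have h1 : ‖X w‖ = P.eps⁻¹ * ‖cfg U ⟨w, μ⟩ * v (w.shift μ) - v w‖ := norm_covD_eq U v w μ
    rw [h1]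
    exact (mul_le_mul_of_nonneg_left (hMv w μ hw) (inv_nonneg.2 hε.le)).trans hMlocM
  by_cases hfar : P.L ^ k < 64 * ρ
  · ----------------------------------------------------------------------------------------------------------------
    -- FAR PAIRS: the covariant derivative at both bonds
    have hX0 : ‖X x₀‖ ≤ M := hXle (by rw [(supDist_eq_zero_iff x₀ x₀).2 rfl]; exact (min_le_left _ _).trans (Nat.zero_le _))
    have hX1 : ‖X x₁‖ ≤ M := hXle (by rw [(supDist_eq_zero_iff x₁ x₁).2 rfl]; exact (min_le_right _ _).trans (Nat.zero_le _))
    have hW64 : 1 ≤ 64 * W := by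
      have h1 : (1 : ℝ) / 64 ≤ (ρ : ℝ) / n := by
        rw [div_le_div_iff₀ (by norm_num) hn]
        have : ((P.L ^ k : ℕ) : ℝ) ≤ ((64 * ρ : ℕ) : ℝ) := by exact_mod_cast hfar.le
        rw [hnnat] at this; push_cast at this; linarith
      have h2 : ((1 : ℝ) / 64) ^ α ≤ W := Real.rpow_le_rpow (by norm_num) h1 hα0
      have h3 : (1 : ℝ) / 64 ≤ ((1 : ℝ) / 64) ^ α := by
        have := Real.rpow_le_rpow_of_exponent_ge (by norm_num : (0 : ℝ) < 1 / 64) (by norm_num : (1 : ℝ) / 64 ≤ 1) hα1.le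
        rwa [Real.rpow_one] at this
      linarith
    calc ‖stairHol U x₀ x₁ * X x₁ - X x₀‖ ≤ ‖stairHol U x₀ x₁ * X x₁‖ + ‖X x₀‖ := norm_sub_le _ _
      _ = ‖X x₁‖ + ‖X x₀‖ := by rw [norm_mul, norm_stairHol, one_mul]
      _ ≤ 2 * M := by linarith
      _ ≤ 2 * M * (64 * W) := le_mul_of_one_le_right (by positivity) hW64
      _ = 128 * W * M := by ring
      _ ≤ K * W * M := by
          have : (128 : ℝ) ≤ K := by rw [hKdef]; linarith [show 0 ≤ (d : ℝ) * c₀ by positivity]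
          gcongr
  ----------------------------------------------------------------------------------------------------------------
  -- NEAR PAIRS: the staircase
  push Not at hfar
  have hρn : 64 * (ρ : ℝ) ≤ n := by rw [← hnnat]; exact_mod_cast hfar
  have hr8 : 8 * (P.L ^ k / 8) ≤ P.L ^ k := Nat.mul_div_le (P.L ^ k) 8
  -- every corner within `ρ` of `x₀` is `L^k`-deep and its local balls lie in the data balls of `x₀`
  have hdeepw : ∀ w₀ : Balaban1983to89.Site P 0, supDist x₀ w₀ ≤ ρ → ∀ u, u ∉ B → P.L ^ k ≤ supDist w₀ u := by
    intro w₀ hw₀ u hu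
    have h1 := hdeep₀ u hu
    have h2 := supDist_triangle x₀ w₀ u
    omega
  have hSw : ∀ w₀ : Balaban1983to89.Site P 0, supDist x₀ w₀ ≤ ρ → ∀ z, supDist w₀ z ≤ 2 * (P.L ^ k / 8) + P.L ^ k + 1 → ‖v z‖ ≤ S := by
    intro w₀ hw₀ z hz
    refine hSv z ((min_le_left _ _).trans ?_)
    have h2 := supDist_triangle x₀ w₀ z
    omega
  have hMw : ∀ w₀ : Balaban1983to89.Site P 0, supDist x₀ w₀ ≤ ρ → ∀ z ν, supDist w₀ z ≤ 2 * (P.L ^ k / 8) →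
      ‖cfg U ⟨z, ν⟩ * v (z.shift ν) - v z‖ ≤ Mloc := by
    intro w₀ hw₀ z ν hz
    refine hMv z ν ((min_le_left _ _).trans ?_)
    have h2 := supDist_triangle x₀ w₀ z
    omega
  -- the per-leg bound
  have hsα : ∀ {s : ℕ}, s ≤ ρ → ((s : ℝ) / n) ^ α ≤ W := fun {s} hs =>
    Real.rpow_le_rpow (by positivity) (div_le_div_of_nonneg_right (by exact_mod_cast hs) hn.le) hα0
  have hlegB : ∀ l, l < P.d → ‖legHol U x₀ x₁ l * X (stairPt x₀ x₁ (l + 1)) - X (stairPt x₀ x₁ l)‖ ≤ c₀ * W * M := by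
    intro l hl
    set m : Fin P.d := ⟨l, hl⟩ with hm
    set w := stairPt x₀ x₁ l with hw
    set w' := stairPt x₀ x₁ (l + 1) with hw'
    set sf : ℕ := (x₁ m - x₀ m).val with hsf
    set sb : ℕ := (x₀ m - x₁ m).val with hsb
    have hmin : min sf sb ≤ ρ := min_val_le_supDist x₀ x₁ m
    by_cases hcase : sf ≤ sb
    · -- forward leg (or trivial leg)
      have hlegdef : legHol U x₀ x₁ l = toC (axisHol U m sf w) := by
        rw [legHol, dif_pos hl]; simp only [← hm, ← hsf, ← hsb, if_pos hcase, hw]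
      have hw'eq : w' = runSite w m sf := by rw [hw', hw, hsf, hm]; exact stairPt_succ_eq_runSite x₀ x₁ ⟨l, hl⟩
      rcases Nat.eq_zero_or_pos sf with h0 | hpos
      · -- trivial leg
        have : w' = w := by rw [hw'eq, h0, runSite_zero]
        rw [hlegdef, h0, axisHol_zero, toC_one, one_mul, this, sub_self, norm_zero]; positivity
      · have hsfρ : sf ≤ ρ := by rw [min_eq_left hcase] at hmin; exact hmin
        have h := hlegP w m μ sf hpos (by omega) (hdeepw w (supDist_stairPt_le x₀ x₁ l)) f S Mloc hS0 hMloc0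
          (hSw w (supDist_stairPt_le x₀ x₁ l)) (hMw w (supDist_stairPt_le x₀ x₁ l))
        rw [← hw'eq] at h
        rw [hlegdef]
        refine h.trans ?_
        calc c₀ * ((sf : ℝ) / n) ^ α * (P.eps⁻¹ * (Mloc + S / n)) ≤ c₀ * W * (P.eps⁻¹ * (Mloc + S / n)) := by
              gcongr; exact hsα hsfρ
          _ = c₀ * W * M := by rw [hMdef]
    · -- backward leg
      push Not at hcase
      have hlegdef : legHol U x₀ x₁ l = conj (toC (axisHol U m sb w')) := by
        rw [legHol, dif_pos hl]; simp only [← hm, ← hsf, ← hsb, if_neg (not_le.2 hcase), hw']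
      have hweq : w = runSite w' m sb := by rw [hw', hw, hsb, hm]; exact stairPt_eq_runSite_succ x₀ x₁ ⟨l, hl⟩
      have hsbρ : sb ≤ ρ := by rw [min_eq_right hcase.le] at hmin; exact hmin
      have hsbpos : 0 < sb := by
        rcases Nat.eq_zero_or_pos sb with h0 | h
        · exfalso
          have hz : x₀ m - x₁ m = 0 := (ZMod.val_eq_zero _).1 h0
          have hsf0 : sf = 0 := by rw [hsf, show x₁ m - x₀ m = 0 by rw [← neg_sub, hz, neg_zero], ZMod.val_zero]
          omega
        · exact h
      have h := hlegP w' m μ sb hsbpos (by omega) (hdeepw w' (supDist_stairPt_le x₀ x₁ (l + 1))) f S Mloc hS0 hMloc0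
        (hSw w' (supDist_stairPt_le x₀ x₁ (l + 1))) (hMw w' (supDist_stairPt_le x₀ x₁ (l + 1)))
      rw [← hweq] at h
      -- `‖conj(a)·X(w′) − X(w)‖ = ‖a·X(w) − X(w′)‖`
      have hnormeq : ‖conj (toC (axisHol U m sb w')) * X w' - X w‖ = ‖toC (axisHol U m sb w') * X w - X w'‖ := by
        set aa := toC (axisHol U m sb w') with haa
        have h1 : conj aa * aa = 1 := conj_mul_toC _
        have e : conj aa * X w' - X w = -(conj aa * (aa * X w - X w')) := by linear_combination (X w) * h1
        rw [e, norm_neg, norm_mul, Complex.norm_conj, haa, norm_toC, one_mul]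
      rw [hlegdef, hnormeq]
      refine h.trans ?_
      calc c₀ * ((sb : ℝ) / n) ^ α * (P.eps⁻¹ * (Mloc + S / n)) ≤ c₀ * W * (P.eps⁻¹ * (Mloc + S / n)) := by
            gcongr; exact hsα hsbρ
        _ = c₀ * W * M := by rw [hMdef]
  -- telescoping
  have htel := stair_telescope U x₀ x₁ X P.d
  rw [stairPt_zero, stairPt_of_le x₀ x₁ le_rfl] at htel
  calc ‖stairHol U x₀ x₁ * X x₁ - X x₀‖ = ‖(∏ l ∈ Finset.range P.d, legHol U x₀ x₁ l) * X x₁ - X x₀‖ := rfl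
    _ ≤ ∑ l ∈ Finset.range P.d, ‖legHol U x₀ x₁ l * X (stairPt x₀ x₁ (l + 1)) - X (stairPt x₀ x₁ l)‖ := htel
    _ ≤ ∑ _l ∈ Finset.range P.d, c₀ * W * M := Finset.sum_le_sum fun l hl => hlegB l (Finset.mem_range.1 hl)
    _ = P.d * (c₀ * W * M) := by rw [Finset.sum_const, Finset.card_range, nsmul_eq_mul]
    _ = (P.d * c₀) * W * M := by ring
    _ ≤ K * W * M := by
        have : (P.d : ℝ) * c₀ ≤ K := by rw [hKdef, hPdR]; linarith
        gcongr

end AllPairs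

/-! ## §5 THE MEMBER: the Hölder quotient of `D_u δG_k(□,Ω)f` at small fields from the value and `D_u` members of the clause -/

section Member

/-- kernel: trading a rate `δ′ ≥ δ` and a shift of the distance by `m` block units for the factor `e^{δm}`:
`e^{−δ′X′/n} ≤ e^{δm}·e^{−δX/n}` when `X − mn ≤ X′`, `X′ ≥ 0`. [cite: Balaban1983RegularityDecay, Theorem p.573 (1.12)] -/
private theorem exp_shift_le {δ δ' n X X' m : ℝ} (hδ0 : 0 ≤ δ) (hδδ' : δ ≤ δ') (hn : 0 < n) (hX' : 0 ≤ X') (h : X - m * n ≤ X') :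
    Real.exp (-(δ' * (n⁻¹ * X'))) ≤ Real.exp (δ * m) * Real.exp (-(δ * (n⁻¹ * X))) := by
  rw [← Real.exp_add]
  refine Real.exp_le_exp.2 ?_
  have h1 : δ * (n⁻¹ * X') ≤ δ' * (n⁻¹ * X') := mul_le_mul_of_nonneg_right hδδ' (mul_nonneg (inv_nonneg.2 hn.le) hX')
  have h2 : n⁻¹ * (X - m * n) ≤ n⁻¹ * X' := mul_le_mul_of_nonneg_left h (inv_nonneg.2 hn.le)
  have h3 : n⁻¹ * (X - m * n) = n⁻¹ * X - m := by field_simp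
  rw [h3] at h2
  have h4 := mul_le_mul_of_nonneg_left h2 hδ0
  linarith

set_option maxHeartbeats 400000 in
/-- **THE HÖLDER MEMBER (ORDER `1+α`) OF THE `δG_k(□,Ω)` CLAUSE [Balaban1983RegularityDecay] (1.11)–(1.12) AT SMALL NON-FLAT `U(1)` FIELDS,
`k`-UNIFORM, OPERATOR FORM, FROM THE VALUE MEMBER AND THE COVARIANT-DERIVATIVE MEMBER OF THE CLAUSE** — Theorem p. 573: *"If Ω ⊂ Ω₀,
then for δG_k(Ω,Ω₀,A) = G_k(Ω,A) − G_k(Ω₀,A), (1.11) we have the inequalities (1.5) and (1.6) [= (1.9), (1.10)] (with the same restrictions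
on x, x′) with the additional factor exp(−δ₀dist(x,Ω^c))exp(−δ₀dist(supp f,Ω^c)) (1.12) on the right hand sides"*, (1.9) = *"1/|x − x′|^α
|U(A(Γ_{x,x′}))(D^η_{A,μ}G_k(Ω,A)f)(x′) − (D^η_{A,μ}G_k(Ω,A)f)(x)| ≦ c₀exp(−δ₀dist({x,x′}, supp f))‖f‖_∞ for x, x′ ∈ Ω, and satisfying the
condition dist({x,x′},Ω^c) ≧ R₀"*, for [BalabanImbrieJaffe1985] p. 326 *"The propagators arising from Δ_k(u_k) … also satisfy the regularity
and decay estimates of [7]"* and [BalabanImbrieJaffe1988] p. 263 *"Bounds analogous to (2.30), (2.31) hold for covariant derivatives and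
Hölder derivatives of G_{k,loc}(u) of order less than two"* — here for p31's region Neumann propagators `G_k(X,u) = gBox (α_kL^{kd}) ε⁻¹ u k X`
on NESTED `k`-BLOCK UNIONS `□ ⊆ Ω`, `v = G_k(□,u)f − G_k(Ω,u)f`: for `P.d = d ≥ 2`, `L` odd `> 1`, `a > 0`, `0 ≤ α < 1`, constants
`c₁ ≥ 0, δ₁ > 0` (value member), `c₂ ≥ 0, δ₂ > 0` (`D_u` member) and depths `R₁ ≥ 0`, `R₂` (block units) THERE ARE `c₃, δ₃ > 0` such that
for every volume, `1 ≤ k ≤ K`, every `U(1)` field with all oriented plaquettes within `θ` of `1`, `2d³(L^{2k}θ)² ≤ 1`, every nested pair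
`□ ⊆ Ω` CARRYING (hV) the value member of the clause on the rows of `□` at depth `≥ R₁L^k` (p30's `close112_smallField_of_inputs` conclusion
shape: `‖v(x)‖ ≤ (L^kε)²·c₁e^{−δ₁D/L^k}e^{−δ₁(D_b+D_f)/L^k}F`) and (hD) the covariant-derivative member on the rows at depth `≥ R₂L^k`
(`‖(D_uv)(⟨x,μ⟩)‖ ≤ (L^kε)·c₂e^{−δ₂D/L^k}e^{−δ₂(D_b+D_f)/L^k}F`) — HYPOTHESES, instantiated by the producers of those members —, every pair
of distinct rows `x₀, x₁ ∈ □` both at depth `≥ (max(R₁,R₂)+3)L^k` below `T∖□`, every direction `μ` and every `f` supported in `□` with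
`‖f‖ ≤ F`, `D ≤ dist(x_i, supp f)`, `D_b ≤ dist(x_i, □^c)`, `D_f ≤ dist(supp f, □^c)`:
`(L^k/|x₀−x₁|_∞)^α·‖U(Γ_{x₀,x₁})(D_uv)(⟨x₁,μ⟩) − (D_uv)(⟨x₀,μ⟩)‖ ≤ (L^kε)·c₃e^{−δ₃D/L^k}e^{−δ₃(D_b+D_f)/L^k}F` — ONE power of `L^kε`, as the
`D_u` member; `δ₃ = min(δ₁,δ₂)`, `c₃ = c_{§4}(c₁+c₂)e^{4δ₃} + 1`.  Proof: §4 with `S`, `M_loc` read off (hV), (hD) on the `2L^k`-balls about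
the pair (every such site lies in `□` at depth `≥ (max(R₁,R₂)+1)L^k`, and sees `supp f` / `□^c` at distances `≥ D − 2L^k` / `≥ D_b − 2L^k`).
[cite: Balaban1983RegularityDecay, Theorem p.573 (1.9), (1.11)–(1.12)] [cite: BalabanImbrieJaffe1985, (7.3.1) p.326] [cite: BalabanImbrieJaffe1988, p.263, (2.31)] -/
theorem closeHolder112_of_members (d L : ℕ) (hd2 : 2 ≤ d) (hL : Odd L ∧ 1 < L) {a : ℝ} (ha : 0 < a) {α : ℝ} (hα0 : 0 ≤ α)
    (hα1 : α < 1) {c₁ δ₁ c₂ δ₂ R₁ : ℝ} (R₂ : ℝ) (hc₁ : 0 ≤ c₁) (hδ₁ : 0 < δ₁) (hc₂ : 0 ≤ c₂) (hδ₂ : 0 < δ₂) (hR₁ : 0 ≤ R₁) :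
    ∃ c₃ δ₃ : ℝ, 0 < c₃ ∧ 0 < δ₃ ∧ ∀ (P : Params), P.d = d → P.L = L → ∀ k : ℕ, 1 ≤ k → k ≤ P.K →
      ∀ (U : GaugeField P 0 U1) (θ : ℝ), (∀ (y : Balaban1983to89.Site P 0) (μ ν : Fin P.d), ‖plaqC U y μ ν - 1‖ ≤ θ) →
        2 * (P.d : ℝ) ^ 3 * (((P.L : ℝ) ^ k) ^ 2 * θ) ^ 2 ≤ 1 →
      ∀ (B Ω : Finset (Balaban1983to89.Site P 0)), IsBlockUnion k B → IsBlockUnion k Ω → B ⊆ Ω →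
      (∀ x ∈ B, (∀ w, w ∉ B → R₁ * (P.L : ℝ) ^ k ≤ B5Ineq137Torus.T P 0 x w) →
        ∀ (f : Balaban1983to89.Site P 0 → ℂ) (F D Db Df : ℝ), (∀ y, ‖f y‖ ≤ F) → (∀ y, y ∉ B → f y = 0) →
          0 ≤ D → (∀ y, f y ≠ 0 → D ≤ B5Ineq137Torus.T P 0 x y) → 0 ≤ Db → (∀ w, w ∉ B → Db ≤ B5Ineq137Torus.T P 0 x w) →
          0 ≤ Df → (∀ y, f y ≠ 0 → ∀ w, w ∉ B → Df ≤ B5Ineq137Torus.T P 0 y w) →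
          ‖(gBox (B1RG242Torus.α P a k * (P.L : ℝ) ^ (k * P.d)) P.eps⁻¹ U k B *ᵥ f) x -
              (gBox (B1RG242Torus.α P a k * (P.L : ℝ) ^ (k * P.d)) P.eps⁻¹ U k Ω *ᵥ f) x‖ ≤
            P.spacing k ^ 2 * (c₁ * Real.exp (-(δ₁ * (((P.L : ℝ) ^ k)⁻¹ * D))) *
              Real.exp (-(δ₁ * (((P.L : ℝ) ^ k)⁻¹ * (Db + Df)))) * F)) →
      (∀ x ∈ B, (∀ w, w ∉ B → R₂ * (P.L : ℝ) ^ k ≤ B5Ineq137Torus.T P 0 x w) →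
        ∀ (f : Balaban1983to89.Site P 0 → ℂ) (F D Db Df : ℝ), (∀ y, ‖f y‖ ≤ F) → (∀ y, y ∉ B → f y = 0) →
          0 ≤ D → (∀ y, f y ≠ 0 → D ≤ B5Ineq137Torus.T P 0 x y) → 0 ≤ Db → (∀ w, w ∉ B → Db ≤ B5Ineq137Torus.T P 0 x w) →
          0 ≤ Df → (∀ y, f y ≠ 0 → ∀ w, w ∉ B → Df ≤ B5Ineq137Torus.T P 0 y w) → ∀ (μ : Fin P.d),
          ‖covD P.eps⁻¹ (cfg U) (gBox (B1RG242Torus.α P a k * (P.L : ℝ) ^ (k * P.d)) P.eps⁻¹ U k B *ᵥ f) ⟨x, μ⟩ -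
              covD P.eps⁻¹ (cfg U) (gBox (B1RG242Torus.α P a k * (P.L : ℝ) ^ (k * P.d)) P.eps⁻¹ U k Ω *ᵥ f) ⟨x, μ⟩‖ ≤
            P.spacing k * (c₂ * Real.exp (-(δ₂ * (((P.L : ℝ) ^ k)⁻¹ * D))) *
              Real.exp (-(δ₂ * (((P.L : ℝ) ^ k)⁻¹ * (Db + Df)))) * F)) →
      ∀ (x₀ x₁ : Balaban1983to89.Site P 0) (μ : Fin P.d), x₀ ≠ x₁ → x₀ ∈ B → x₁ ∈ B →
        (∀ w, w ∉ B → (max R₁ R₂ + 3) * (P.L : ℝ) ^ k ≤ B5Ineq137Torus.T P 0 x₀ w) →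
        (∀ w, w ∉ B → (max R₁ R₂ + 3) * (P.L : ℝ) ^ k ≤ B5Ineq137Torus.T P 0 x₁ w) →
      ∀ (f : Balaban1983to89.Site P 0 → ℂ) (F D Db Df : ℝ), (∀ y, ‖f y‖ ≤ F) → (∀ y, y ∉ B → f y = 0) →
        0 ≤ D → (∀ y, f y ≠ 0 → D ≤ B5Ineq137Torus.T P 0 x₀ y) → (∀ y, f y ≠ 0 → D ≤ B5Ineq137Torus.T P 0 x₁ y) →
        0 ≤ Db → (∀ w, w ∉ B → Db ≤ B5Ineq137Torus.T P 0 x₀ w) → (∀ w, w ∉ B → Db ≤ B5Ineq137Torus.T P 0 x₁ w) →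
        0 ≤ Df → (∀ y, f y ≠ 0 → ∀ w, w ∉ B → Df ≤ B5Ineq137Torus.T P 0 y w) →
        ((P.L : ℝ) ^ k / B5Ineq137Torus.T P 0 x₀ x₁) ^ α *
            ‖stairHol U x₀ x₁ *
                covD P.eps⁻¹ (cfg U) (gBox (B1RG242Torus.α P a k * (P.L : ℝ) ^ (k * P.d)) P.eps⁻¹ U k B *ᵥ f -
                  gBox (B1RG242Torus.α P a k * (P.L : ℝ) ^ (k * P.d)) P.eps⁻¹ U k Ω *ᵥ f) ⟨x₁, μ⟩ -
              covD P.eps⁻¹ (cfg U) (gBox (B1RG242Torus.α P a k * (P.L : ℝ) ^ (k * P.d)) P.eps⁻¹ U k B *ᵥ f -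
                  gBox (B1RG242Torus.α P a k * (P.L : ℝ) ^ (k * P.d)) P.eps⁻¹ U k Ω *ᵥ f) ⟨x₀, μ⟩‖
          ≤ P.spacing k * (c₃ * Real.exp (-(δ₃ * (((P.L : ℝ) ^ k)⁻¹ * D))) *
              Real.exp (-(δ₃ * (((P.L : ℝ) ^ k)⁻¹ * (Db + Df)))) * F) := by
  classical
  obtain ⟨K, hK, hall⟩ := closeHolder_of_local d L hd2 hL ha hα0 hα1
  set δ : ℝ := min δ₁ δ₂ with hδdef
  have hδ : 0 < δ := lt_min hδ₁ hδ₂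
  have hδδ₁ : δ ≤ δ₁ := min_le_left _ _
  have hδδ₂ : δ ≤ δ₂ := min_le_right _ _
  set e2 : ℝ := Real.exp (δ * 2) with he2
  have he2pos : 0 < e2 := Real.exp_pos _
  set C : ℝ := K * ((c₂ + c₁) * (e2 * e2)) with hCdef
  have hC0 : 0 ≤ C := by positivity
  refine ⟨C + 1, δ, by positivity, hδ, ?_⟩
  intro P hPd hPL k hk1 hkK U θ hθ hsmall B Ω hB hΩ hsub hV hD x₀ x₁ μ hne hx₀B hx₁B hdeep₀ hdeep₁ f F D Db Df hF hfB hD0 hsupp₀ hsupp₁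
    hDb0 hDb₀ hDb₁ hDf0 hDf
  have hallP := hall P hPd hPL k hk1 hkK B Ω hB hΩ hsub U θ hθ hsmall
  -- basic quantities
  have hLpos : (0 : ℝ) < P.L := P.cast_L_pos
  set n : ℝ := (P.L : ℝ) ^ k with hndef
  have hn : 0 < n := pow_pos hLpos k
  have hnnat : ((P.L ^ k : ℕ) : ℝ) = n := by push_cast; rw [hndef]
  have hε : 0 < P.eps := P.eps_pos
  have hsp : P.spacing k = n * P.eps := rfl
  have hsp0 : 0 < P.spacing k := P.spacing_pos k
  have hF0 : 0 ≤ F := (norm_nonneg _).trans (hF x₀)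
  set R : ℝ := max R₁ R₂ with hRdef
  have hR0 : 0 ≤ R := hR₁.trans (le_max_left _ _)
  have hRR₁ : R₁ ≤ R := le_max_left _ _
  have hRR₂ : R₂ ≤ R := le_max_right _ _
  set v : Balaban1983to89.Site P 0 → ℂ := gBox (B1RG242Torus.α P a k * (P.L : ℝ) ^ (k * P.d)) P.eps⁻¹ U k B *ᵥ f -
    gBox (B1RG242Torus.α P a k * (P.L : ℝ) ^ (k * P.d)) P.eps⁻¹ U k Ω *ᵥ f with hv
  set ED : ℝ := Real.exp (-(δ * (n⁻¹ * D))) with hED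
  set EB : ℝ := Real.exp (-(δ * (n⁻¹ * (Db + Df)))) with hEB
  have hED0 : 0 < ED := Real.exp_pos _
  have hEB0 : 0 < EB := Real.exp_pos _
  set G : ℝ := e2 * e2 * ED * EB * F with hGdef
  have hG0 : 0 ≤ G := by positivity
  -- the two end points are `2L^k`-deep (in lattice units)
  have hdeepN : ∀ {x : Balaban1983to89.Site P 0}, (∀ w, w ∉ B → (R + 3) * n ≤ B5Ineq137Torus.T P 0 x w) →
      ∀ w, w ∉ B → 2 * P.L ^ k ≤ supDist x w := by
    intro x hx w hw
    have h1 := hx w hw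
    rw [B3Bound323ZeroTorus.T_eq_supDist] at h1
    have h2 : 2 * n ≤ (R + 3) * n := mul_le_mul_of_nonneg_right (by linarith) hn.le
    have h3 : ((2 * P.L ^ k : ℕ) : ℝ) ≤ (supDist x w : ℝ) := by push_cast; rw [hndef] at h1 h2; linarith
    exact_mod_cast h3
  -- the sites of the data balls: in `□`, deep, and at controlled distances from `supp f` and `□^c`
  have hballpt : ∀ {x : Balaban1983to89.Site P 0}, (∀ w, w ∉ B → (R + 3) * n ≤ B5Ineq137Torus.T P 0 x w) →
      (∀ y, f y ≠ 0 → D ≤ B5Ineq137Torus.T P 0 x y) → (∀ w, w ∉ B → Db ≤ B5Ineq137Torus.T P 0 x w) →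
      ∀ z, supDist x z ≤ 2 * P.L ^ k →
        z ∈ B ∧ (∀ w, w ∉ B → (R + 1) * n ≤ B5Ineq137Torus.T P 0 z w) ∧
          (∀ y, f y ≠ 0 → max (D - 2 * n) 0 ≤ B5Ineq137Torus.T P 0 z y) ∧
          (∀ w, w ∉ B → max (Db - 2 * n) 0 ≤ B5Ineq137Torus.T P 0 z w) := by
    intro x hx hsuppx hDbx z hz
    have hxz : B5Ineq137Torus.T P 0 x z ≤ 2 * n := by
      rw [B3Bound323ZeroTorus.T_eq_supDist, ← hnnat]; exact_mod_cast hz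
    have htri : ∀ w, B5Ineq137Torus.T P 0 x w ≤ B5Ineq137Torus.T P 0 x z + B5Ineq137Torus.T P 0 z w := fun w =>
      B5Ineq137Torus.T_triangle P 0 x z w
    refine ⟨?_, fun w hw => ?_, fun y hy => ?_, fun w hw => ?_⟩
    · by_contra hzB
      have h1 := hx z hzB
      have h2 : 3 * n ≤ (R + 3) * n := mul_le_mul_of_nonneg_right (by linarith) hn.le
      linarith
    · have h1 := hx w hw
      have h2 := htri w
      linarith
    · refine max_le ?_ (B5Ineq137Torus.T_nonneg P 0 z y)
      have h1 := hsuppx y hy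
      have h2 := htri y
      linarith
    · refine max_le ?_ (B5Ineq137Torus.T_nonneg P 0 z w)
      have h1 := hDbx w hw
      have h2 := htri w
      linarith
  -- the exponential bookkeeping on the balls
  have hexpD : Real.exp (-(δ₁ * (n⁻¹ * max (D - 2 * n) 0))) ≤ e2 * ED ∧ Real.exp (-(δ₂ * (n⁻¹ * max (D - 2 * n) 0))) ≤ e2 * ED :=
    ⟨exp_shift_le hδ.le hδδ₁ hn (le_max_right _ _) (by linarith [le_max_left (D - 2 * n) 0]),
     exp_shift_le hδ.le hδδ₂ hn (le_max_right _ _) (by linarith [le_max_left (D - 2 * n) 0])⟩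
  have hexpB : Real.exp (-(δ₁ * (n⁻¹ * (max (Db - 2 * n) 0 + Df)))) ≤ e2 * EB ∧
      Real.exp (-(δ₂ * (n⁻¹ * (max (Db - 2 * n) 0 + Df)))) ≤ e2 * EB :=
    ⟨exp_shift_le hδ.le hδδ₁ hn (add_nonneg (le_max_right _ _) hDf0) (by linarith [le_max_left (Db - 2 * n) 0]),
     exp_shift_le hδ.le hδδ₂ hn (add_nonneg (le_max_right _ _) hDf0) (by linarith [le_max_left (Db - 2 * n) 0])⟩
  -- the local data
  set S : ℝ := P.spacing k ^ 2 * (c₁ * G) with hSdef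
  have hS0 : 0 ≤ S := by positivity
  set Mloc : ℝ := P.eps * (P.spacing k * (c₂ * G)) with hMlocdef
  have hMloc0 : 0 ≤ Mloc := by positivity
  have hdata : ∀ {x : Balaban1983to89.Site P 0}, (∀ w, w ∉ B → (R + 3) * n ≤ B5Ineq137Torus.T P 0 x w) →
      (∀ y, f y ≠ 0 → D ≤ B5Ineq137Torus.T P 0 x y) → (∀ w, w ∉ B → Db ≤ B5Ineq137Torus.T P 0 x w) →
      ∀ z, supDist x z ≤ 2 * P.L ^ k → ‖v z‖ ≤ S ∧ ∀ ν, ‖cfg U ⟨z, ν⟩ * v (z.shift ν) - v z‖ ≤ Mloc := by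
    intro x hx hsuppx hDbx z hz
    obtain ⟨hzB, hzdeep, hzsupp, hzDb⟩ := hballpt hx hsuppx hDbx z hz
    have hzR₁ : ∀ w, w ∉ B → R₁ * n ≤ B5Ineq137Torus.T P 0 z w := fun w hw =>
      (mul_le_mul_of_nonneg_right (by linarith) hn.le).trans (hzdeep w hw)
    have hzR₂ : ∀ w, w ∉ B → R₂ * n ≤ B5Ineq137Torus.T P 0 z w := fun w hw =>
      (mul_le_mul_of_nonneg_right (by linarith) hn.le).trans (hzdeep w hw)
    refine ⟨?_, fun ν => ?_⟩
    · have h := hV z hzB hzR₁ f F (max (D - 2 * n) 0) (max (Db - 2 * n) 0) Df hF hfB (le_max_right _ _) hzsupp (le_max_right _ _)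
        hzDb hDf0 hDf
      refine h.trans ?_
      rw [hSdef, hGdef]
      have h1 := hexpD.1
      have h2 := hexpB.1
      calc P.spacing k ^ 2 * (c₁ * Real.exp (-(δ₁ * (n⁻¹ * max (D - 2 * n) 0))) *
            Real.exp (-(δ₁ * (n⁻¹ * (max (Db - 2 * n) 0 + Df)))) * F)
          ≤ P.spacing k ^ 2 * (c₁ * (e2 * ED) * (e2 * EB) * F) := by gcongr
        _ = P.spacing k ^ 2 * (c₁ * (e2 * e2 * ED * EB * F)) := by ring
    · have h := hD z hzB hzR₂ f F (max (D - 2 * n) 0) (max (Db - 2 * n) 0) Df hF hfB (le_max_right _ _) hzsupp (le_max_right _ _)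
        hzDb hDf0 hDf ν
      rw [← covD_sub, norm_covD_eq] at h
      have h' : ‖cfg U ⟨z, ν⟩ * v (z.shift ν) - v z‖ ≤ P.eps * (P.spacing k * (c₂ * Real.exp (-(δ₂ * (n⁻¹ * max (D - 2 * n) 0))) *
          Real.exp (-(δ₂ * (n⁻¹ * (max (Db - 2 * n) 0 + Df)))) * F)) := by
        have := mul_le_mul_of_nonneg_left h hε.le
        rwa [← mul_assoc, mul_inv_cancel₀ hε.ne', one_mul] at this
      refine h'.trans ?_
      rw [hMlocdef, hGdef]
      have h1 := hexpD.2
      have h2 := hexpB.2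
      calc P.eps * (P.spacing k * (c₂ * Real.exp (-(δ₂ * (n⁻¹ * max (D - 2 * n) 0))) *
            Real.exp (-(δ₂ * (n⁻¹ * (max (Db - 2 * n) 0 + Df)))) * F))
          ≤ P.eps * (P.spacing k * (c₂ * (e2 * ED) * (e2 * EB) * F)) := by gcongr
        _ = P.eps * (P.spacing k * (c₂ * (e2 * e2 * ED * EB * F))) := by ring
  have hdeep₀' : ∀ w, w ∉ B → (R + 3) * n ≤ B5Ineq137Torus.T P 0 x₀ w := fun w hw => by rw [hRdef, hndef]; exact hdeep₀ w hw
  have hdeep₁' : ∀ w, w ∉ B → (R + 3) * n ≤ B5Ineq137Torus.T P 0 x₁ w := fun w hw => by rw [hRdef, hndef]; exact hdeep₁ w hw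
  have hSv : ∀ z, min (supDist x₀ z) (supDist x₁ z) ≤ 2 * P.L ^ k → ‖v z‖ ≤ S := by
    intro z hz
    rcases le_total (supDist x₀ z) (supDist x₁ z) with h | h
    · rw [min_eq_left h] at hz; exact (hdata hdeep₀' hsupp₀ hDb₀ z hz).1
    · rw [min_eq_right h] at hz; exact (hdata hdeep₁' hsupp₁ hDb₁ z hz).1
  have hMv : ∀ z ν, min (supDist x₀ z) (supDist x₁ z) ≤ P.L ^ k → ‖cfg U ⟨z, ν⟩ * v (z.shift ν) - v z‖ ≤ Mloc := by
    intro z ν hz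
    rcases le_total (supDist x₀ z) (supDist x₁ z) with h | h
    · rw [min_eq_left h] at hz; exact (hdata hdeep₀' hsupp₀ hDb₀ z (by omega)).2 ν
    · rw [min_eq_right h] at hz; exact (hdata hdeep₁' hsupp₁ hDb₁ z (by omega)).2 ν
  -- §4
  have hmain := hallP x₀ x₁ μ hne (hdeepN hdeep₀') (hdeepN hdeep₁') f S Mloc hS0 hMloc0 hSv hMv
  rw [← B3Bound323ZeroTorus.T_eq_supDist] at hmain
  refine hmain.trans ?_
  -- the arithmetic of the local unit
  have hunit : P.eps⁻¹ * (Mloc + S / (P.L : ℝ) ^ k) = P.spacing k * ((c₂ + c₁) * G) := by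
    rw [hMlocdef, hSdef, ← hndef, hsp]; field_simp
  rw [hunit]
  have hGE : G = e2 * e2 * (ED * EB * F) := by rw [hGdef]; ring
  calc K * (P.spacing k * ((c₂ + c₁) * G)) = P.spacing k * (C * (ED * EB * F)) := by rw [hCdef, hGE]; ring
    _ ≤ P.spacing k * ((C + 1) * (ED * EB * F)) := by
        have h0 : 0 ≤ P.spacing k * (ED * EB * F) := by positivity
        linarith
    _ = P.spacing k * ((C + 1) * Real.exp (-(δ * (((P.L : ℝ) ^ k)⁻¹ * D))) *
          Real.exp (-(δ * (((P.L : ℝ) ^ k)⁻¹ * (Db + Df)))) * F) := by rw [hED, hEB, hndef]; ring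

end Member

/-! ## §6 The member with the value input DISCHARGED by p30's `close112_smallField_of_inputs` -/

section OfInputs

/-- **THE HÖLDER MEMBER OF THE `δG_k(□,Ω)` CLAUSE AT SMALL NON-FLAT FIELDS, FROM THE (H1.10″) VALUE MEMBERS OF `G_k(□,u)`, `G_k(Ω,u)` AND THE
COVARIANT-DERIVATIVE MEMBER OF THE CLAUSE** — §5 with the value member of the clause supplied BY NAME by p30's
`BIJ88NeumannPropagatorSmallFieldClose.close112_smallField_of_inputs` (rows at depth `≥ 10L^k`): for `2 ≤ d ≤ 3`, `L` odd `> 1`, `a > 0`,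
`c₀ ≥ 0, δ₀ > 0` (the (H1.10″) value members of `G_k(□,u)` and `G_k(Ω,u)` on the rows of `□`, hypotheses `hGB`/`hGΩ` exactly as in p30's
theorem), `0 ≤ α < 1`, and `c₂ ≥ 0, δ₂ > 0`, `R₂` (the covariant-derivative member of the clause on the rows at depth `≥ R₂L^k`,
hypothesis — its producer at small fields is p30's `…CloseDeriv` lane) THERE ARE `c₃, δ₃ > 0` with the conclusion of §5 at every pair of
distinct rows both at depth `≥ (max(10,R₂)+3)L^k`.
[cite: Balaban1983RegularityDecay, Theorem p.573 (1.9), (1.11)–(1.12)] [cite: BalabanImbrieJaffe1985, (7.3.1) p.326, (4.6.2) p.313] [cite: BalabanImbrieJaffe1988, p.263, (2.31)] -/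
theorem closeHolder112_smallField_of_inputs (d L : ℕ) (hd : 2 ≤ d) (hd3 : d ≤ 3) (hL : Odd L ∧ 1 < L) {a : ℝ} (ha : 0 < a)
    {c₀ δ₀ : ℝ} (hc₀ : 0 ≤ c₀) (hδ₀ : 0 < δ₀) {α : ℝ} (hα0 : 0 ≤ α) (hα1 : α < 1)
    {c₂ δ₂ : ℝ} (R₂ : ℝ) (hc₂ : 0 ≤ c₂) (hδ₂ : 0 < δ₂) :
    ∃ c₃ δ₃ : ℝ, 0 < c₃ ∧ 0 < δ₃ ∧ ∀ (P : Params), P.d = d → P.L = L → ∀ k : ℕ, 1 ≤ k → k ≤ P.K →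
      ∀ (U : GaugeField P 0 U1) (θ : ℝ), (∀ (y : Balaban1983to89.Site P 0) (μ ν : Fin P.d), ‖plaqC U y μ ν - 1‖ ≤ θ) →
        2 * (P.d : ℝ) ^ 3 * (((P.L : ℝ) ^ k) ^ 2 * θ) ^ 2 ≤ 1 →
      ∀ (B Ω : Finset (Balaban1983to89.Site P 0)), IsBlockUnion k B → IsBlockUnion k Ω → B ⊆ Ω →
      (∀ x ∈ B, ∀ (f : Balaban1983to89.Site P 0 → ℂ) (F D : ℝ), (∀ y, ‖f y‖ ≤ F) → 0 ≤ D →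
          (∀ y, f y ≠ 0 → D ≤ B5Ineq137Torus.T P 0 x y) →
          ‖(gBox (B1RG242Torus.α P a k * (P.L : ℝ) ^ (k * P.d)) P.eps⁻¹ U k B *ᵥ f) x‖ ≤
            P.spacing k ^ 2 * (c₀ * Real.exp (-(δ₀ * (((P.L : ℝ) ^ k)⁻¹ * D))) * F)) →
      (∀ x ∈ B, ∀ (f : Balaban1983to89.Site P 0 → ℂ) (F D : ℝ), (∀ y, ‖f y‖ ≤ F) → 0 ≤ D →
          (∀ y, f y ≠ 0 → D ≤ B5Ineq137Torus.T P 0 x y) →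
          ‖(gBox (B1RG242Torus.α P a k * (P.L : ℝ) ^ (k * P.d)) P.eps⁻¹ U k Ω *ᵥ f) x‖ ≤
            P.spacing k ^ 2 * (c₀ * Real.exp (-(δ₀ * (((P.L : ℝ) ^ k)⁻¹ * D))) * F)) →
      (∀ x ∈ B, (∀ w, w ∉ B → R₂ * (P.L : ℝ) ^ k ≤ B5Ineq137Torus.T P 0 x w) →
        ∀ (f : Balaban1983to89.Site P 0 → ℂ) (F D Db Df : ℝ), (∀ y, ‖f y‖ ≤ F) → (∀ y, y ∉ B → f y = 0) →
          0 ≤ D → (∀ y, f y ≠ 0 → D ≤ B5Ineq137Torus.T P 0 x y) → 0 ≤ Db → (∀ w, w ∉ B → Db ≤ B5Ineq137Torus.T P 0 x w) →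
          0 ≤ Df → (∀ y, f y ≠ 0 → ∀ w, w ∉ B → Df ≤ B5Ineq137Torus.T P 0 y w) → ∀ (μ : Fin P.d),
          ‖covD P.eps⁻¹ (cfg U) (gBox (B1RG242Torus.α P a k * (P.L : ℝ) ^ (k * P.d)) P.eps⁻¹ U k B *ᵥ f) ⟨x, μ⟩ -
              covD P.eps⁻¹ (cfg U) (gBox (B1RG242Torus.α P a k * (P.L : ℝ) ^ (k * P.d)) P.eps⁻¹ U k Ω *ᵥ f) ⟨x, μ⟩‖ ≤
            P.spacing k * (c₂ * Real.exp (-(δ₂ * (((P.L : ℝ) ^ k)⁻¹ * D))) *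
              Real.exp (-(δ₂ * (((P.L : ℝ) ^ k)⁻¹ * (Db + Df)))) * F)) →
      ∀ (x₀ x₁ : Balaban1983to89.Site P 0) (μ : Fin P.d), x₀ ≠ x₁ → x₀ ∈ B → x₁ ∈ B →
        (∀ w, w ∉ B → (max 10 R₂ + 3) * (P.L : ℝ) ^ k ≤ B5Ineq137Torus.T P 0 x₀ w) →
        (∀ w, w ∉ B → (max 10 R₂ + 3) * (P.L : ℝ) ^ k ≤ B5Ineq137Torus.T P 0 x₁ w) →
      ∀ (f : Balaban1983to89.Site P 0 → ℂ) (F D Db Df : ℝ), (∀ y, ‖f y‖ ≤ F) → (∀ y, y ∉ B → f y = 0) →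
        0 ≤ D → (∀ y, f y ≠ 0 → D ≤ B5Ineq137Torus.T P 0 x₀ y) → (∀ y, f y ≠ 0 → D ≤ B5Ineq137Torus.T P 0 x₁ y) →
        0 ≤ Db → (∀ w, w ∉ B → Db ≤ B5Ineq137Torus.T P 0 x₀ w) → (∀ w, w ∉ B → Db ≤ B5Ineq137Torus.T P 0 x₁ w) →
        0 ≤ Df → (∀ y, f y ≠ 0 → ∀ w, w ∉ B → Df ≤ B5Ineq137Torus.T P 0 y w) →
        ((P.L : ℝ) ^ k / B5Ineq137Torus.T P 0 x₀ x₁) ^ α *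
            ‖stairHol U x₀ x₁ *
                covD P.eps⁻¹ (cfg U) (gBox (B1RG242Torus.α P a k * (P.L : ℝ) ^ (k * P.d)) P.eps⁻¹ U k B *ᵥ f -
                  gBox (B1RG242Torus.α P a k * (P.L : ℝ) ^ (k * P.d)) P.eps⁻¹ U k Ω *ᵥ f) ⟨x₁, μ⟩ -
              covD P.eps⁻¹ (cfg U) (gBox (B1RG242Torus.α P a k * (P.L : ℝ) ^ (k * P.d)) P.eps⁻¹ U k B *ᵥ f -
                  gBox (B1RG242Torus.α P a k * (P.L : ℝ) ^ (k * P.d)) P.eps⁻¹ U k Ω *ᵥ f) ⟨x₀, μ⟩‖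
          ≤ P.spacing k * (c₃ * Real.exp (-(δ₃ * (((P.L : ℝ) ^ k)⁻¹ * D))) *
              Real.exp (-(δ₃ * (((P.L : ℝ) ^ k)⁻¹ * (Db + Df)))) * F) := by
  obtain ⟨c₁, δ₁, hc₁, hδ₁, hclose⟩ := close112_smallField_of_inputs d L hd hd3 hL ha hc₀ hδ₀
  obtain ⟨c₃, δ₃, hc₃, hδ₃, H⟩ := closeHolder112_of_members d L hd hL ha hα0 hα1 R₂ hc₁.le hδ₁ hc₂ hδ₂
    (by norm_num : (0 : ℝ) ≤ 10)
  refine ⟨c₃, δ₃, hc₃, hδ₃, ?_⟩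
  intro P hPd hPL k hk1 hkK U θ hθ hsmall B Ω hB hΩ hsub hGB hGΩ hD
  exact H P hPd hPL k hk1 hkK U θ hθ hsmall B Ω hB hΩ hsub (hclose P hPd hPL k hk1 hkK U θ hθ hsmall B Ω hB hΩ hsub hGB hGΩ) hD

/-- kernel: dropping a shift to the positive part inside a decaying exponential — `e^{−δ·c·max(X,0)} ≤ e^{−δ·c·X}` for `δ, c ≥ 0`.
[cite: Balaban1983RegularityDecay, Theorem p.573 (1.12)] -/
private theorem exp_max_le {δ c X : ℝ} (hδ : 0 ≤ δ) (hc : 0 ≤ c) :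
    Real.exp (-(δ * (c * max X 0))) ≤ Real.exp (-(δ * (c * X))) :=
  Real.exp_le_exp.2 (neg_le_neg (mul_le_mul_of_nonneg_left (mul_le_mul_of_nonneg_left (le_max_left _ _) hc) hδ))

/-- **§6 IN THE (H1.12)-HÖLDER INPUT BINDER SHAPE OF THE HYPOTHESIS-FORM CHAIN** — parallel to r18's
`BIJ88LocDerivHolder231RegularTorus.input112_holder_regular_univ` (r01's `holder_covD_gBox_sub_gBox_univ_le` in level-`k` units: direction
first, `x₁ ≠ x₀`, the deep rows as BALL CONDITIONS `T(x_i,y) ≤ R′L^k → y ∈ □`, no sign conditions on `D, D_b, D_f`, one power of `L^kε`,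
the (1.12) bracket `e^{−δ₃(D_b+D_f)/L^k}` explicit), with the transport p30's staircase `stairHol u x₀ x₁` (the small-field convention of
`BIJ88NeumannPropagatorSmallFieldCubeHolderDecay.holder19_smallField_cube_input` / p29's `BIJ88LocDerivHolder230SmallFieldTorus`) — so that
a generic order-`(1+θ)` member of (2.31) reads the regular and the small-field providers through one binder shape.
[cite: Balaban1983RegularityDecay, Theorem p.573 (1.9), (1.11)–(1.12)] [cite: BalabanImbrieJaffe1985, (7.3.1) p.326] [cite: BalabanImbrieJaffe1988, p.263, (2.31)] -/
theorem closeHolder112_smallField_input (d L : ℕ) (hd : 2 ≤ d) (hd3 : d ≤ 3) (hL : Odd L ∧ 1 < L) {a : ℝ} (ha : 0 < a)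
    {c₀ δ₀ : ℝ} (hc₀ : 0 ≤ c₀) (hδ₀ : 0 < δ₀) {α : ℝ} (hα0 : 0 ≤ α) (hα1 : α < 1)
    {c₂ δ₂ : ℝ} (R₂ : ℝ) (hc₂ : 0 ≤ c₂) (hδ₂ : 0 < δ₂) :
    ∃ c₃ δ₃ : ℝ, 0 < c₃ ∧ 0 < δ₃ ∧ ∀ (P : Params), P.d = d → P.L = L → ∀ k : ℕ, 1 ≤ k → k ≤ P.K →
      ∀ (U : GaugeField P 0 U1) (θ : ℝ), (∀ (y : Balaban1983to89.Site P 0) (μ ν : Fin P.d), ‖plaqC U y μ ν - 1‖ ≤ θ) →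
        2 * (P.d : ℝ) ^ 3 * (((P.L : ℝ) ^ k) ^ 2 * θ) ^ 2 ≤ 1 →
      ∀ (B Ω : Finset (Balaban1983to89.Site P 0)), IsBlockUnion k B → IsBlockUnion k Ω → B ⊆ Ω →
      (∀ x ∈ B, ∀ (f : Balaban1983to89.Site P 0 → ℂ) (F D : ℝ), (∀ y, ‖f y‖ ≤ F) → 0 ≤ D →
          (∀ y, f y ≠ 0 → D ≤ B5Ineq137Torus.T P 0 x y) →
          ‖(gBox (B1RG242Torus.α P a k * (P.L : ℝ) ^ (k * P.d)) P.eps⁻¹ U k B *ᵥ f) x‖ ≤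
            P.spacing k ^ 2 * (c₀ * Real.exp (-(δ₀ * (((P.L : ℝ) ^ k)⁻¹ * D))) * F)) →
      (∀ x ∈ B, ∀ (f : Balaban1983to89.Site P 0 → ℂ) (F D : ℝ), (∀ y, ‖f y‖ ≤ F) → 0 ≤ D →
          (∀ y, f y ≠ 0 → D ≤ B5Ineq137Torus.T P 0 x y) →
          ‖(gBox (B1RG242Torus.α P a k * (P.L : ℝ) ^ (k * P.d)) P.eps⁻¹ U k Ω *ᵥ f) x‖ ≤
            P.spacing k ^ 2 * (c₀ * Real.exp (-(δ₀ * (((P.L : ℝ) ^ k)⁻¹ * D))) * F)) →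
      (∀ x ∈ B, (∀ w, w ∉ B → R₂ * (P.L : ℝ) ^ k ≤ B5Ineq137Torus.T P 0 x w) →
        ∀ (f : Balaban1983to89.Site P 0 → ℂ) (F D Db Df : ℝ), (∀ y, ‖f y‖ ≤ F) → (∀ y, y ∉ B → f y = 0) →
          0 ≤ D → (∀ y, f y ≠ 0 → D ≤ B5Ineq137Torus.T P 0 x y) → 0 ≤ Db → (∀ w, w ∉ B → Db ≤ B5Ineq137Torus.T P 0 x w) →
          0 ≤ Df → (∀ y, f y ≠ 0 → ∀ w, w ∉ B → Df ≤ B5Ineq137Torus.T P 0 y w) → ∀ (μ : Fin P.d),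
          ‖covD P.eps⁻¹ (cfg U) (gBox (B1RG242Torus.α P a k * (P.L : ℝ) ^ (k * P.d)) P.eps⁻¹ U k B *ᵥ f) ⟨x, μ⟩ -
              covD P.eps⁻¹ (cfg U) (gBox (B1RG242Torus.α P a k * (P.L : ℝ) ^ (k * P.d)) P.eps⁻¹ U k Ω *ᵥ f) ⟨x, μ⟩‖ ≤
            P.spacing k * (c₂ * Real.exp (-(δ₂ * (((P.L : ℝ) ^ k)⁻¹ * D))) *
              Real.exp (-(δ₂ * (((P.L : ℝ) ^ k)⁻¹ * (Db + Df)))) * F)) →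
      ∀ (μ : Fin P.d) (x₀ x₁ : Balaban1983to89.Site P 0), x₁ ≠ x₀ →
        (∀ y, B5Ineq137Torus.T P 0 x₀ y ≤ (max 10 R₂ + 3) * (P.L : ℝ) ^ k → y ∈ B) →
        (∀ y, B5Ineq137Torus.T P 0 x₁ y ≤ (max 10 R₂ + 3) * (P.L : ℝ) ^ k → y ∈ B) →
      ∀ (f : Balaban1983to89.Site P 0 → ℂ) (F D Db Df : ℝ), (∀ y, ‖f y‖ ≤ F) → (∀ y, y ∉ B → f y = 0) →
        (∀ y, f y ≠ 0 → D ≤ B5Ineq137Torus.T P 0 x₀ y) → (∀ y, f y ≠ 0 → D ≤ B5Ineq137Torus.T P 0 x₁ y) →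
        (∀ w, w ∉ B → Db ≤ B5Ineq137Torus.T P 0 x₀ w) → (∀ w, w ∉ B → Db ≤ B5Ineq137Torus.T P 0 x₁ w) →
        (∀ y, f y ≠ 0 → ∀ w, w ∉ B → Df ≤ B5Ineq137Torus.T P 0 y w) →
        ((P.L : ℝ) ^ k / B5Ineq137Torus.T P 0 x₀ x₁) ^ α *
            ‖stairHol U x₀ x₁ *
                covD P.eps⁻¹ (cfg U) (gBox (B1RG242Torus.α P a k * (P.L : ℝ) ^ (k * P.d)) P.eps⁻¹ U k B *ᵥ f -
                  gBox (B1RG242Torus.α P a k * (P.L : ℝ) ^ (k * P.d)) P.eps⁻¹ U k Ω *ᵥ f) ⟨x₁, μ⟩ -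
              covD P.eps⁻¹ (cfg U) (gBox (B1RG242Torus.α P a k * (P.L : ℝ) ^ (k * P.d)) P.eps⁻¹ U k B *ᵥ f -
                  gBox (B1RG242Torus.α P a k * (P.L : ℝ) ^ (k * P.d)) P.eps⁻¹ U k Ω *ᵥ f) ⟨x₀, μ⟩‖
          ≤ P.spacing k * (c₃ * Real.exp (-(δ₃ * (((P.L : ℝ) ^ k)⁻¹ * D))) *
              Real.exp (-(δ₃ * (((P.L : ℝ) ^ k)⁻¹ * (Db + Df)))) * F) := by
  obtain ⟨c₃, δ₃, hc₃, hδ₃, H⟩ := closeHolder112_smallField_of_inputs d L hd hd3 hL ha hc₀ hδ₀ hα0 hα1 R₂ hc₂ hδ₂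
  refine ⟨c₃, δ₃, hc₃, hδ₃, ?_⟩
  intro P hPd hPL k hk1 hkK U θ hθ hsmall B Ω hB hΩ hsub hGB hGΩ hD μ x₀ x₁ hne hball₀ hball₁ f F D Db Df hF hfB hsupp₀ hsupp₁
    hDb₀ hDb₁ hDf
  have hn : (0 : ℝ) < (P.L : ℝ) ^ k := pow_pos P.cast_L_pos k
  have hF0 : 0 ≤ F := (norm_nonneg _).trans (hF x₀)
  have hR : (0 : ℝ) ≤ (max 10 R₂ + 3) * (P.L : ℝ) ^ k :=
    mul_nonneg (by linarith [le_max_left (10 : ℝ) R₂]) hn.le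
  -- ball conditions ⇒ membership and depth
  have hmem : ∀ {x : Balaban1983to89.Site P 0}, (∀ y, B5Ineq137Torus.T P 0 x y ≤ (max 10 R₂ + 3) * (P.L : ℝ) ^ k → y ∈ B) →
      x ∈ B ∧ ∀ w, w ∉ B → (max 10 R₂ + 3) * (P.L : ℝ) ^ k ≤ B5Ineq137Torus.T P 0 x w := by
    intro x hball
    refine ⟨hball x (by rw [B5Ineq137Torus.T_self]; exact hR), fun w hw => ?_⟩
    by_contra hlt
    exact hw (hball w (not_le.1 hlt).le)
  obtain ⟨hx₀B, hdeep₀⟩ := hmem hball₀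
  obtain ⟨hx₁B, hdeep₁⟩ := hmem hball₁
  have h := H P hPd hPL k hk1 hkK U θ hθ hsmall B Ω hB hΩ hsub hGB hGΩ hD x₀ x₁ μ hne.symm hx₀B hx₁B hdeep₀ hdeep₁ f F
    (max D 0) (max Db 0) (max Df 0) hF hfB (le_max_right _ _)
    (fun y hy => max_le (hsupp₀ y hy) (B5Ineq137Torus.T_nonneg P 0 x₀ y))
    (fun y hy => max_le (hsupp₁ y hy) (B5Ineq137Torus.T_nonneg P 0 x₁ y)) (le_max_right _ _)
    (fun w hw => max_le (hDb₀ w hw) (B5Ineq137Torus.T_nonneg P 0 x₀ w))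
    (fun w hw => max_le (hDb₁ w hw) (B5Ineq137Torus.T_nonneg P 0 x₁ w)) (le_max_right _ _)
    (fun y hy w hw => max_le (hDf y hy w hw) (B5Ineq137Torus.T_nonneg P 0 y w))
  refine h.trans ?_
  have hc : 0 ≤ ((P.L : ℝ) ^ k)⁻¹ := inv_nonneg.2 hn.le
  have e1 : Real.exp (-(δ₃ * (((P.L : ℝ) ^ k)⁻¹ * max D 0))) ≤ Real.exp (-(δ₃ * (((P.L : ℝ) ^ k)⁻¹ * D))) :=
    exp_max_le hδ₃.le hc
  have e2 : Real.exp (-(δ₃ * (((P.L : ℝ) ^ k)⁻¹ * (max Db 0 + max Df 0)))) ≤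
      Real.exp (-(δ₃ * (((P.L : ℝ) ^ k)⁻¹ * (Db + Df)))) :=
    Real.exp_le_exp.2 (neg_le_neg (mul_le_mul_of_nonneg_left
      (mul_le_mul_of_nonneg_left (add_le_add (le_max_left _ _) (le_max_left _ _)) hc) hδ₃.le))
  have hsp : 0 ≤ P.spacing k := (P.spacing_pos k).le
  gcongr

end OfInputs

/-! ## §8 The member from the four (H1.10″) inputs: both members of the clause DISCHARGED BY NAME (p30's p353959 + p355499) -/

section OfInputs110

/-- **THE HÖLDER MEMBER OF THE `δG_k(□,Ω)` CLAUSE AT SMALL NON-FLAT FIELDS FROM THE FOUR (H1.10″) INPUTS** — §6 with the covariant-derivative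
member of the clause ALSO discharged BY NAME, by p30 gen 28's `BIJ88NeumannPropagatorSmallFieldCloseDeriv.close112_smallField_deriv_of_inputs`
(p355499, rows at depth `≥ 14L^k`): the hypotheses are EXACTLY those of that theorem — block-scale plaquette smallness, nested `k`-block unions
`□ ⊆ Ω`, the (H1.10″) VALUE members `hGB`/`hGΩ` of `G_k(□,u)`, `G_k(Ω,u)` on the rows of `□` and the (H1.10″) COVARIANT-DERIVATIVE members
`hDB`/`hDΩ` on the rows whose open `L^k`-ball lies in `□`, all four at one `(c₀, δ₀)` (producers: this seat's `decay110_smallField_input` /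
`decay110_smallField_cube_input` / `decay110_smallField_region_deep_input`, p34's `decay110_smallField_cube_deriv_input` /
`decay110_smallField_region_input`, p30's `decay110_smallField_deriv`) — and the conclusion is §5's at every pair of distinct rows of `□` both
at depth `≥ 17L^k`: for `2 ≤ d ≤ 3`, `L` odd `> 1`, `a > 0`, `c₀ ≥ 0`, `δ₀ > 0`, `0 ≤ α < 1` there are `c₃, δ₃ > 0` depending on these only.
With this the three members (value p353959, covariant derivative p355499, Hölder) of [Balaban1983RegularityDecay] (1.11)–(1.12) at small
non-flat `U(1)` fields are in the tree in `k`-uniform operator form, modulo the (H1.10″) inputs.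
[cite: Balaban1983RegularityDecay, Theorem p.573 (1.9), (1.11)–(1.12)] [cite: BalabanImbrieJaffe1985, (7.3.1) p.326, (4.6.2) p.313] [cite: BalabanImbrieJaffe1988, p.263, (2.31)] -/
theorem closeHolder112_smallField_of_inputs110 (d L : ℕ) (hd : 2 ≤ d) (hd3 : d ≤ 3) (hL : Odd L ∧ 1 < L) {a : ℝ} (ha : 0 < a)
    {c₀ δ₀ : ℝ} (hc₀ : 0 ≤ c₀) (hδ₀ : 0 < δ₀) {α : ℝ} (hα0 : 0 ≤ α) (hα1 : α < 1) :
    ∃ c₃ δ₃ : ℝ, 0 < c₃ ∧ 0 < δ₃ ∧ ∀ (P : Params), P.d = d → P.L = L → ∀ k : ℕ, 1 ≤ k → k ≤ P.K →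
      ∀ (U : GaugeField P 0 U1) (θ : ℝ), (∀ (y : Balaban1983to89.Site P 0) (μ ν : Fin P.d), ‖plaqC U y μ ν - 1‖ ≤ θ) →
        2 * (P.d : ℝ) ^ 3 * (((P.L : ℝ) ^ k) ^ 2 * θ) ^ 2 ≤ 1 →
      ∀ (B Ω : Finset (Balaban1983to89.Site P 0)), IsBlockUnion k B → IsBlockUnion k Ω → B ⊆ Ω →
      (∀ x ∈ B, ∀ (f : Balaban1983to89.Site P 0 → ℂ) (F D : ℝ), (∀ y, ‖f y‖ ≤ F) → 0 ≤ D →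
          (∀ y, f y ≠ 0 → D ≤ B5Ineq137Torus.T P 0 x y) →
          ‖(gBox (B1RG242Torus.α P a k * (P.L : ℝ) ^ (k * P.d)) P.eps⁻¹ U k B *ᵥ f) x‖ ≤
            P.spacing k ^ 2 * (c₀ * Real.exp (-(δ₀ * (((P.L : ℝ) ^ k)⁻¹ * D))) * F)) →
      (∀ x ∈ B, ∀ (f : Balaban1983to89.Site P 0 → ℂ) (F D : ℝ), (∀ y, ‖f y‖ ≤ F) → 0 ≤ D →
          (∀ y, f y ≠ 0 → D ≤ B5Ineq137Torus.T P 0 x y) →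
          ‖(gBox (B1RG242Torus.α P a k * (P.L : ℝ) ^ (k * P.d)) P.eps⁻¹ U k Ω *ᵥ f) x‖ ≤
            P.spacing k ^ 2 * (c₀ * Real.exp (-(δ₀ * (((P.L : ℝ) ^ k)⁻¹ * D))) * F)) →
      (∀ x, (∀ y, B5Ineq137Torus.T P 0 x y < (P.L : ℝ) ^ k → y ∈ B) →
          ∀ (f : Balaban1983to89.Site P 0 → ℂ) (F D : ℝ), (∀ y, ‖f y‖ ≤ F) → 0 ≤ D →
          (∀ y, f y ≠ 0 → D ≤ B5Ineq137Torus.T P 0 x y) → ∀ (μ : Fin P.d),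
          ‖covD P.eps⁻¹ (cfg U) (gBox (B1RG242Torus.α P a k * (P.L : ℝ) ^ (k * P.d)) P.eps⁻¹ U k B *ᵥ f) ⟨x, μ⟩‖ ≤
            P.spacing k * (c₀ * Real.exp (-(δ₀ * (((P.L : ℝ) ^ k)⁻¹ * D))) * F)) →
      (∀ x, (∀ y, B5Ineq137Torus.T P 0 x y < (P.L : ℝ) ^ k → y ∈ B) →
          ∀ (f : Balaban1983to89.Site P 0 → ℂ) (F D : ℝ), (∀ y, ‖f y‖ ≤ F) → 0 ≤ D →
          (∀ y, f y ≠ 0 → D ≤ B5Ineq137Torus.T P 0 x y) → ∀ (μ : Fin P.d),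
          ‖covD P.eps⁻¹ (cfg U) (gBox (B1RG242Torus.α P a k * (P.L : ℝ) ^ (k * P.d)) P.eps⁻¹ U k Ω *ᵥ f) ⟨x, μ⟩‖ ≤
            P.spacing k * (c₀ * Real.exp (-(δ₀ * (((P.L : ℝ) ^ k)⁻¹ * D))) * F)) →
      ∀ (x₀ x₁ : Balaban1983to89.Site P 0) (μ : Fin P.d), x₀ ≠ x₁ → x₀ ∈ B → x₁ ∈ B →
        (∀ w, w ∉ B → 17 * (P.L : ℝ) ^ k ≤ B5Ineq137Torus.T P 0 x₀ w) →
        (∀ w, w ∉ B → 17 * (P.L : ℝ) ^ k ≤ B5Ineq137Torus.T P 0 x₁ w) →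
      ∀ (f : Balaban1983to89.Site P 0 → ℂ) (F D Db Df : ℝ), (∀ y, ‖f y‖ ≤ F) → (∀ y, y ∉ B → f y = 0) →
        0 ≤ D → (∀ y, f y ≠ 0 → D ≤ B5Ineq137Torus.T P 0 x₀ y) → (∀ y, f y ≠ 0 → D ≤ B5Ineq137Torus.T P 0 x₁ y) →
        0 ≤ Db → (∀ w, w ∉ B → Db ≤ B5Ineq137Torus.T P 0 x₀ w) → (∀ w, w ∉ B → Db ≤ B5Ineq137Torus.T P 0 x₁ w) →
        0 ≤ Df → (∀ y, f y ≠ 0 → ∀ w, w ∉ B → Df ≤ B5Ineq137Torus.T P 0 y w) →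
        ((P.L : ℝ) ^ k / B5Ineq137Torus.T P 0 x₀ x₁) ^ α *
            ‖stairHol U x₀ x₁ *
                covD P.eps⁻¹ (cfg U) (gBox (B1RG242Torus.α P a k * (P.L : ℝ) ^ (k * P.d)) P.eps⁻¹ U k B *ᵥ f -
                  gBox (B1RG242Torus.α P a k * (P.L : ℝ) ^ (k * P.d)) P.eps⁻¹ U k Ω *ᵥ f) ⟨x₁, μ⟩ -
              covD P.eps⁻¹ (cfg U) (gBox (B1RG242Torus.α P a k * (P.L : ℝ) ^ (k * P.d)) P.eps⁻¹ U k B *ᵥ f -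
                  gBox (B1RG242Torus.α P a k * (P.L : ℝ) ^ (k * P.d)) P.eps⁻¹ U k Ω *ᵥ f) ⟨x₀, μ⟩‖
          ≤ P.spacing k * (c₃ * Real.exp (-(δ₃ * (((P.L : ℝ) ^ k)⁻¹ * D))) *
              Real.exp (-(δ₃ * (((P.L : ℝ) ^ k)⁻¹ * (Db + Df)))) * F) := by
  obtain ⟨c₂, δ₂, hc₂, hδ₂, hder⟩ := close112_smallField_deriv_of_inputs d L hd hd3 hL ha hc₀ hδ₀
  obtain ⟨c₃, δ₃, hc₃, hδ₃, H⟩ := closeHolder112_smallField_of_inputs d L hd hd3 hL ha hc₀ hδ₀ hα0 hα1 14 hc₂.le hδ₂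
  refine ⟨c₃, δ₃, hc₃, hδ₃, ?_⟩
  intro P hPd hPL k hk1 hkK U θ hθ hsmall B Ω hB hΩ hsub hGB hGΩ hDB hDΩ x₀ x₁ μ hne hx₀B hx₁B hdeep₀ hdeep₁
  have h17 : (max 10 14 + 3 : ℝ) = 17 := by norm_num
  have hD := hder P hPd hPL k hk1 hkK U θ hθ hsmall B Ω hB hΩ hsub hGB hGΩ hDB hDΩ
  have h := H P hPd hPL k hk1 hkK U θ hθ hsmall B Ω hB hΩ hsub hGB hGΩ hD x₀ x₁ μ hne hx₀B hx₁B
  rw [h17] at h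
  exact h hdeep₀ hdeep₁

/-- **§8 IN THE (H1.12)-HÖLDER INPUT BINDER SHAPE** (as §7: direction first, `x₁ ≠ x₀`, deep rows as the ball conditions
`T(x_i,y) ≤ 17L^k → y ∈ □`, no sign conditions on `D, D_b, D_f`, transport `stairHol`) — the small-field provider for a generic order-`(1+θ)`
member of (2.31) read through the binder of r18's `input112_holder_regular_univ`.
[cite: Balaban1983RegularityDecay, Theorem p.573 (1.9), (1.11)–(1.12)] [cite: BalabanImbrieJaffe1985, (7.3.1) p.326] [cite: BalabanImbrieJaffe1988, p.263, (2.31)] -/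
theorem closeHolder112_smallField_input110 (d L : ℕ) (hd : 2 ≤ d) (hd3 : d ≤ 3) (hL : Odd L ∧ 1 < L) {a : ℝ} (ha : 0 < a)
    {c₀ δ₀ : ℝ} (hc₀ : 0 ≤ c₀) (hδ₀ : 0 < δ₀) {α : ℝ} (hα0 : 0 ≤ α) (hα1 : α < 1) :
    ∃ c₃ δ₃ : ℝ, 0 < c₃ ∧ 0 < δ₃ ∧ ∀ (P : Params), P.d = d → P.L = L → ∀ k : ℕ, 1 ≤ k → k ≤ P.K →
      ∀ (U : GaugeField P 0 U1) (θ : ℝ), (∀ (y : Balaban1983to89.Site P 0) (μ ν : Fin P.d), ‖plaqC U y μ ν - 1‖ ≤ θ) →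
        2 * (P.d : ℝ) ^ 3 * (((P.L : ℝ) ^ k) ^ 2 * θ) ^ 2 ≤ 1 →
      ∀ (B Ω : Finset (Balaban1983to89.Site P 0)), IsBlockUnion k B → IsBlockUnion k Ω → B ⊆ Ω →
      (∀ x ∈ B, ∀ (f : Balaban1983to89.Site P 0 → ℂ) (F D : ℝ), (∀ y, ‖f y‖ ≤ F) → 0 ≤ D →
          (∀ y, f y ≠ 0 → D ≤ B5Ineq137Torus.T P 0 x y) →
          ‖(gBox (B1RG242Torus.α P a k * (P.L : ℝ) ^ (k * P.d)) P.eps⁻¹ U k B *ᵥ f) x‖ ≤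
            P.spacing k ^ 2 * (c₀ * Real.exp (-(δ₀ * (((P.L : ℝ) ^ k)⁻¹ * D))) * F)) →
      (∀ x ∈ B, ∀ (f : Balaban1983to89.Site P 0 → ℂ) (F D : ℝ), (∀ y, ‖f y‖ ≤ F) → 0 ≤ D →
          (∀ y, f y ≠ 0 → D ≤ B5Ineq137Torus.T P 0 x y) →
          ‖(gBox (B1RG242Torus.α P a k * (P.L : ℝ) ^ (k * P.d)) P.eps⁻¹ U k Ω *ᵥ f) x‖ ≤
            P.spacing k ^ 2 * (c₀ * Real.exp (-(δ₀ * (((P.L : ℝ) ^ k)⁻¹ * D))) * F)) →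
      (∀ x, (∀ y, B5Ineq137Torus.T P 0 x y < (P.L : ℝ) ^ k → y ∈ B) →
          ∀ (f : Balaban1983to89.Site P 0 → ℂ) (F D : ℝ), (∀ y, ‖f y‖ ≤ F) → 0 ≤ D →
          (∀ y, f y ≠ 0 → D ≤ B5Ineq137Torus.T P 0 x y) → ∀ (μ : Fin P.d),
          ‖covD P.eps⁻¹ (cfg U) (gBox (B1RG242Torus.α P a k * (P.L : ℝ) ^ (k * P.d)) P.eps⁻¹ U k B *ᵥ f) ⟨x, μ⟩‖ ≤
            P.spacing k * (c₀ * Real.exp (-(δ₀ * (((P.L : ℝ) ^ k)⁻¹ * D))) * F)) →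
      (∀ x, (∀ y, B5Ineq137Torus.T P 0 x y < (P.L : ℝ) ^ k → y ∈ B) →
          ∀ (f : Balaban1983to89.Site P 0 → ℂ) (F D : ℝ), (∀ y, ‖f y‖ ≤ F) → 0 ≤ D →
          (∀ y, f y ≠ 0 → D ≤ B5Ineq137Torus.T P 0 x y) → ∀ (μ : Fin P.d),
          ‖covD P.eps⁻¹ (cfg U) (gBox (B1RG242Torus.α P a k * (P.L : ℝ) ^ (k * P.d)) P.eps⁻¹ U k Ω *ᵥ f) ⟨x, μ⟩‖ ≤
            P.spacing k * (c₀ * Real.exp (-(δ₀ * (((P.L : ℝ) ^ k)⁻¹ * D))) * F)) →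
      ∀ (μ : Fin P.d) (x₀ x₁ : Balaban1983to89.Site P 0), x₁ ≠ x₀ →
        (∀ y, B5Ineq137Torus.T P 0 x₀ y ≤ 17 * (P.L : ℝ) ^ k → y ∈ B) →
        (∀ y, B5Ineq137Torus.T P 0 x₁ y ≤ 17 * (P.L : ℝ) ^ k → y ∈ B) →
      ∀ (f : Balaban1983to89.Site P 0 → ℂ) (F D Db Df : ℝ), (∀ y, ‖f y‖ ≤ F) → (∀ y, y ∉ B → f y = 0) →
        (∀ y, f y ≠ 0 → D ≤ B5Ineq137Torus.T P 0 x₀ y) → (∀ y, f y ≠ 0 → D ≤ B5Ineq137Torus.T P 0 x₁ y) →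
        (∀ w, w ∉ B → Db ≤ B5Ineq137Torus.T P 0 x₀ w) → (∀ w, w ∉ B → Db ≤ B5Ineq137Torus.T P 0 x₁ w) →
        (∀ y, f y ≠ 0 → ∀ w, w ∉ B → Df ≤ B5Ineq137Torus.T P 0 y w) →
        ((P.L : ℝ) ^ k / B5Ineq137Torus.T P 0 x₀ x₁) ^ α *
            ‖stairHol U x₀ x₁ *
                covD P.eps⁻¹ (cfg U) (gBox (B1RG242Torus.α P a k * (P.L : ℝ) ^ (k * P.d)) P.eps⁻¹ U k B *ᵥ f -
                  gBox (B1RG242Torus.α P a k * (P.L : ℝ) ^ (k * P.d)) P.eps⁻¹ U k Ω *ᵥ f) ⟨x₁, μ⟩ -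
              covD P.eps⁻¹ (cfg U) (gBox (B1RG242Torus.α P a k * (P.L : ℝ) ^ (k * P.d)) P.eps⁻¹ U k B *ᵥ f -
                  gBox (B1RG242Torus.α P a k * (P.L : ℝ) ^ (k * P.d)) P.eps⁻¹ U k Ω *ᵥ f) ⟨x₀, μ⟩‖
          ≤ P.spacing k * (c₃ * Real.exp (-(δ₃ * (((P.L : ℝ) ^ k)⁻¹ * D))) *
              Real.exp (-(δ₃ * (((P.L : ℝ) ^ k)⁻¹ * (Db + Df)))) * F) := by
  obtain ⟨c₂, δ₂, hc₂, hδ₂, hder⟩ := close112_smallField_deriv_of_inputs d L hd hd3 hL ha hc₀ hδ₀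
  obtain ⟨c₃, δ₃, hc₃, hδ₃, H⟩ := closeHolder112_smallField_input d L hd hd3 hL ha hc₀ hδ₀ hα0 hα1 14 hc₂.le hδ₂
  refine ⟨c₃, δ₃, hc₃, hδ₃, ?_⟩
  intro P hPd hPL k hk1 hkK U θ hθ hsmall B Ω hB hΩ hsub hGB hGΩ hDB hDΩ μ x₀ x₁ hne hball₀ hball₁
  have h17 : (max 10 14 + 3 : ℝ) = 17 := by norm_num
  have hD := hder P hPd hPL k hk1 hkK U θ hθ hsmall B Ω hB hΩ hsub hGB hGΩ hDB hDΩ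
  have h := H P hPd hPL k hk1 hkK U θ hθ hsmall B Ω hB hΩ hsub hGB hGΩ hD μ x₀ x₁ hne
  rw [h17] at h
  exact h hball₀ hball₁

end OfInputs110

end

end Literature.MathematicalPhysics.QuantumFieldTheory.BalabanImbrieJaffe1984to88.BIJ88NeumannPropagatorSmallFieldCloseHolder
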